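import Mathlib
import HarnessLib
import Summits.NavierStokesRegularity.NavierStokesRegularity.Theses.QuarterLogPincer
import Summits.NavierStokesRegularity.NavierStokesRegularity.Theorems.QuarterLogPincerThinCascadeDefs
import Summits.NavierStokesRegularity.NavierStokesRegularity.Theorems.QuarterLogPincerTruncationEdgeDefs
import Summits.NavierStokesRegularity.NavierStokesRegularity.Theorems.QuarterLogPincerTruncationEdgeCore
import Summits.NavierStokesRegularity.NavierStokesRegularity.Theorems.QuarterLogPincerTypeIQuantSubcubicExpTruncationEdgeStubs
import Summits.NavierStokesRegularity.NavierStokesRegularity.Theorems.QuarterLogPincerTruncationEdgeAnatomyDefs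
import Summits.NavierStokesRegularity.NavierStokesRegularity.Theorems.QuarterLogPincerTruncationEdgeFrameBootstrap
import Summits.NavierStokesRegularity.NavierStokesRegularity.Theorems.QuarterLogPincerQuietCollarDefs
import Summits.NavierStokesRegularity.NavierStokesRegularity.Theorems.QuarterLogPincerQuietCollarLever
import Summits.NavierStokesRegularity.NavierStokesRegularity.Theorems.QuarterLogPincerQuietCollarShadowing
import Literature.Analysis.FluidPDE.SelfSimilar
import Literature.Analysis.FluidPDE.TypeIAncientMild
import Literature.Analysis.FluidPDE.DyadicChaining

/-!
# Line `quiet-collar` for crux `QuarterLogPincer.TypeIQuantSubcubicExp` (stmt-NavierStokesRegularity-24077)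

ns-idea-7 g9 (lens «nearmiss», target «DSS wall»).  LOOP-CLOSING LINE (calibration polarity; successor of
the now sorry-free EDGE line `truncation_edge` v1.9.3, commit 11e1c74768f7).  v1.1: Q1 ANATOMY — the
load-bearing stub Q1 is DERIVED (kernel) from three standard pieces QP1–QP3 and the LANDED frame bootstrap P2;
v1.2: QP1 = QP1a (spike box) ∘ QP1b (collar counting), QP3 = QP3a (lossy sup) + QP3b (lossless `L³`), both derived.
v1.3: QP1b `stub_collarCounting` PROVED (grid + pigeonhole + slice counting; no PDE) — QP1 now rests on QP1a alone.
v1.5 (2026-08-29, g10): REBASE on the landed QP3 `…QuietCollarShadowing.stub_forcedTwoNormShadowing` (typer g36) —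
registered sorries now EXACTLY THREE: QP2 `stub_cutPair` (the one open piece of the edge Q1), Q3 `stub_localRateFloor` (value
upgrade; de-flickered class-restricted form Q3♭ in the sibling line `quiet_core`), Q2 `stub_logCubeExtraction` (converse).
v1.6 (2026-08-29, g10): additive — Q3♭ `LocalRateFloorLogCube` (the form the loop consumes) is PROVED in `Lines/quiet_core.lean` v1.5
(`localRateFloorLogCube`, via `quietCore_all`); here `logCubeLiouville_of_typeIQuantSubcubicExp_flat` records that the value upgrade
needs only Q1 + Q3♭.  Registered stubs unchanged (QP2, Q3, Q2); recommendation: re-cut Q3 to Q3♭.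

## The near-miss of record and its measured deficit

* LEFT of the crux (tree, kernel): `typeIQuantSubcubicExp_of_rateLiouville` (rate-class Liouville ⇒ 24077)
  and the sharper `typeIQuantSubcubicExp_of_thinTowerLiouville` / `exists_thin_singular_abTower_of_not_
  typeIQuantSubcubicExp` (line `ab_root`, `Theorems/QuarterLogPincerTypeIQuantSubcubicExpABRoot.lean`):
  ¬24077 produces a SINGULAR Type-I ancient mild object whose apex trace is LOG-THIN on annuli.
* RIGHT of the crux (line `truncation_edge` v1.9.1, kernel, no sorry): 24077 ⇒ no ENVELOPED singular Type-I
  ancient mild object (`typeIQuantSubcubicExp_implies_envelopeLiouville`, `…_implies_envelopedThinLiouville`: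
  `ThinObject M q v g → HasTypeIDecay A v → False`).
* MEASURED DEFICIT = the pointwise KNSS envelope `HasTypeIDecay A v` (`|v(s,x)| ≤ A/(|x|+√(−s))`): it enters
  the right edge in exactly TWO places — (a) T3, the LOG-SHAPED CUBE BUDGET `EnvelopeCubeBudget v` of the
  localised slices (what the arithmetic core consumes), and (b) the localisation of Leray's floor point into
  the unit ball (`truncatedFamily_of_parts`, `ε ≤ (c/(2(A+c)))²`) — plus, inside T1, the SUP-SMALLNESS
  `≤ A/ρ` of the removed tail, which is what made far-field truncation stability a Gronwall estimate.
* SINGLE INPUT = **QUIET-COLLAR TRUNCATION STABILITY** (stub Q1 below): T1's conclusion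
  `FarFieldTruncation M' v` (some virtual rate constant `M'`) for Type-I ancient mild fields that carry only
  the log-shaped cube budget (a) and NO pointwise decay.  The envelope's use (a) thereby becomes a class hypothesis that the LEFT side can
  plausibly deliver (stub Q2: the thin singular A–B tower of `ab_root`, upgraded to all-time log-cube budgets
  by a rising-sun selection of scales), its use (b) is ABSORBED INTO THE CLASS: the Liouville value speaks of fields carrying a LOCALISED
  LERAY FLOOR (`LocalRateFloor v`, the rate realised inside the unit ball near the apex — PROVED here for every
  enveloped field singular at the apex, from the landed T4; its derivation from bare `SingularAt v 0` is the
  optional stub Q3), and the crux becomes literally a Liouville theorem: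
  `typeIQuantSubcubicExp_iff_logCubeFloorLiouville : Q1 → Q2 → (24077 ↔ LogCubeFloorLiouville)` (kernel-checked;
  the 24077 ⇒ direction uses Q1 ALONE).

## Why this line and why it is easier than the crux (lever = the QUIET COLLAR; v1.1 CORRECTED mechanism)

Without an envelope the removed far field is `O(M/√(−s))` pointwise and is NOT small in any norm at a fixed
radius: the log-cube budget only bounds the `L³`-mass of each ball `B(0,R)` by `(B(1+log R+log(1/ε)))^{1/3}`
per slice.  Three facts make a truncation shadowable nonetheless (kernel-checked composition
`farFieldTruncation_of_quietAnatomy : QP1 → QP2 → QP3 → P2 → FarFieldTruncation M v`, SAME rate constant):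
* (QP1, THE LEVER) SPIKES ARE EXPENSIVE, SO A QUIET COLLAR EXISTS AT A POLYNOMIAL RADIUS.  By the Type-I
  derivative bounds on `[−1,−ε]` (`|∇v| ≲ C_M/(−s)`, `|∂_s v| ≲ C_M(−s)^{−3/2}`; tree pattern
  `exists_gauge_norm_fderiv_le_of_typeI`) a point with `|v(s,x)| > ηq` forces `|v| > ηq/2` on a parabolic box
  of space-time `L³`-mass `μ ≳ ηq⁷ ε^{9/2}/C_M⁴`; the time-integrated budget of `B(0,3ρ)` is
  `≤ B(1+log 3ρ+log(2/ε))`, so (Vitali) at most `B(…)/μ` disjoint boxes exist and the radii `r ∈ [ρ,2ρ]` whose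
  collar `{r ≤ |x| ≤ r+Lq}` meets a spike at SOME time of `[−1,−ε]` have measure `≲ (Lq + 10r_η)B(…)/μ < ρ`
  once `ρ` is polynomially large: a collar quiet (`|v| ≤ ηq`) at ALL times, of any polynomial width `Lq`,
  at polynomial radius.  This is a covering lemma about Type-I fields with a log budget — far below the crux.
* (QP2) THE CUT PAIR.  Radial `χ` (`= 1` on `B(r)`, transition of width `~Lq` inside the collar): REFERENCE
  `V = χ·v(·−1)` — NOT divergence-free, and it need not be: QP3 is stated for references with a MILD DEFECT
  `V(t) − e^{tΔ}V(0) + B₀(V,V)(t)` (`mildDefect`); DATUM `u₀ = P(χ v(−1))` (Leray projection), made compactly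
  supported by a far Bogovskiĭ shell (tree `bogovskii_annulus_smooth_corrector`).  SUP sizes are polynomially
  SMALL (data error `|∇Δ⁻¹(∇χ·v)| ≲ ηq log`, defect = commutators `[χ,e^{tΔ}]`, `[χ, e^{τΔ}P∇·]` with `L¹`
  kernel norms `≲ √t/Lq`, `log(Lq/√τ)/Lq`, plus the `(χ−χ²)v⊗v` term killed by quietness); `L³` sizes are
  `O(b)` (Riesz transforms; budget) and CANNOT be small: a divergence-free datum equal to `v(−1)` on `B(r)`
  carries the flux of `v(−1)` through the collar, which costs interior `L³`-mass comparable to the potential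
  flow, `O(b)` in general.
* (QP3) FORCED TWO-NORM SHADOWING (pure perturbation theory around a rate-`M` drift, Type-I RATE only).  SUP:
  Henry–Gronwall across `log₂(1/ε)` dyadic blocks loses `ε^{−κ(M)}` (P3a of `truncation_edge`) but is fed only
  polynomially small sup inputs ⇒ `‖u−V‖_∞ ≤ δ/2`.  `L³`: LOSSLESS once `‖u−V‖_∞` is small, because the
  bilinear terms are bounded by `‖u−V‖_∞(‖u‖₃+‖V‖₃)` (Young, `‖∇O_τ‖_{L¹} ≲ τ^{−1/2}`): `‖u−V‖₃ ≤ K(β + b·δ/2)`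
  with `β, b` the log-sized `L³` data/defect and reference levels — exactly clause (ii) of `FarFieldTruncation`
  (kernel: `k := K₃(K₂(b*+1) + b*·δ/2)`, `k³ ≤ 4(B+1)(K₃(K₂+2))³(1+log R+log(1/ε))`).
* (P2) the frame bootstrap is the LANDED `TruncationEdge.stub_frameBootstrap`
  (`Theorems/QuarterLogPincerTruncationEdgeFrameBootstrap.lean`), BY NAME.
So Q1 is three pieces each strictly below the crux — a covering lemma (QP1), a cut-off construction with
commutator estimates (QP2), finite-time perturbation theory of ONE smooth NS solution (QP3) — none speaks of
singular objects, rates `F(A)` or Liouville theorems.  DEAD SUB-MECHANISMS (v1.0 sketch → v1.1, recorded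
honestly): «`L³`-small divergence-free data from an `L³`-thin collar» (flux obstruction above — WRONG in v1.0);
«`L³`-Gronwall with polynomial loss» (cannot take log-sized inputs; replaced by lossy-SUP / lossless-`L³`);
«thin collar + divergence-free corrector» (any corrector is `≳ ηq·r/Lq` pointwise while spike counting forces
`r ≫ Lq`; replaced by the non-solenoidal reference with a defect); «cone-potential corrector
`exists_divFree_truncation`» (needs the envelope; replaced by Leray projection + far Bogovskiĭ shell);
«`L³`-thin collar by pigeonholing sub-shells» (true but useless: thin is not quiet, and quiet is what the
`(χ−χ²)v⊗v` defect term needs).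

## Registered obligations (sorries ONLY here; v1.4: five — QP1 is LANDED by name, QP1b is PROVED)

* QP1 `stub_quietCollar : StubQuietCollar` — THE LEVER — is the LANDED theorem of
  `Theorems/QuarterLogPincerQuietCollarLever.lean` (typer g36, 2026-08-28 23:44Z; objects re-homed verbatim in
  `Theorems/QuarterLogPincerQuietCollarDefs.lean`), imported BY NAME (v1.4).  The v1.2 anatomy QP1a `StubSpikeBox`
  (Type-I smoothing at scale) + QP1b `stub_collarCounting : StubCollarCounting` (PROVED in v1.3: grid of radii,
  pigeonhole on start times, `card_mul_le_of_floor_balls`) with `stubQuietCollar_of_parts` stays as an alternative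
  road; QP1a is no longer a registered stub.
* QP2 `stub_cutPair : StubCutPair` — the cut pair `(V = χv(·−1), u₀ = P(χv(−1))` truncated) with polynomially
  small SUP and `O(b)` `L³` data error / mild defect (cut-off + commutator + Riesz/Bogovskiĭ estimates).
* QP3 `stub_forcedTwoNormShadowing : StubForcedTwoNormShadowing` is the LANDED theorem of
  `Theorems/QuarterLogPincerQuietCollarShadowing.lean` (typer g36, 2026-08-29 00:31Z; with `…DefectRestart`,
  `…QuasiMildStability`, `…ShadowingTools`), imported BY NAME (v1.5).  The v1.1 anatomy QP3a `StubSupForcedShadowing`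
  + QP3b `StubL3LosslessStep` with the proved composition `forcedTwoNormShadowing_of_parts` stays as an alternative road;
  QP3a/QP3b are no longer registered stubs.
  (Q1 `stub_quietTruncation : StubQuietTruncation` is a THEOREM modulo QP2 ALONE: `stubQuietTruncation_of_anatomy` applied to
  the landed QP1, QP2, the landed QP3 and the landed `TruncationEdge.stub_frameBootstrap`.)
* Q2 `stub_logCubeExtraction : StubLogCubeExtraction` — ¬24077 ⇒ a log-cube Type-I ancient mild field WITH A
  LOCALISED FLOOR (upgrade of `ab_root`'s thin singular A–B tower: all-time log-cube budgets on balls by a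
  rising-sun / maximal-function selection of the cheap cascade's scales before the KNSS limit + lower
  semicontinuity; the floor by centring each zoom on a rate-carrying point).  Converse direction ONLY.
* Q3 `stub_localRateFloor : StubLocalRateFloor` — localised Leray floor from bare `SingularAt v 0` (NOT used
  by the loop; upgrades the value to the `SingularAt` form `LogCubeLiouville`).  PROVED for enveloped fields
  (`localRateFloor_of_hasTypeIDecay`); nearest print Barker–Prange 2020 Thm 2 (tree
  `BarkerPrange2020_thm2_holds`, Leray–Hopf + Morrey Type-I); risk = flicker (24374/24453).

## Kernel-checked (no sorry)

`farFieldTruncation_of_quietAnatomy : QP1 → QP2 → QP3 → P2 → FarFieldTruncation M v` (v1.1, THE Q1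
ANATOMY, same rate constant), `stubQuietTruncation_of_anatomy`, `stub_quietTruncation` (Q1, DERIVED);
`stubQuietCollar_of_parts`, `forcedTwoNormShadowing_of_parts` (v1.2; QP1 and QP3 DERIVED);
`truncatedFamily_of_localFloor` (the arithmetic family from T1's conclusion + log-cube budget + a LOCALISED
floor — no envelope anywhere), `not_typeIQuantSubcubicExp_of_logCube_floor`,
`logCubeFloorLiouville_of_typeIQuantSubcubicExp : Q1 → 24077 → LogCubeFloorLiouville` (THE EDGE),
`logCubeLiouville_of_typeIQuantSubcubicExp : Q1 → Q3 → 24077 → LogCubeLiouville` (value upgrade),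
`typeIQuantSubcubicExp_of_logCubeFloorLiouville : Q2 → LogCubeFloorLiouville → 24077` (THE CONVERSE),
`typeIQuantSubcubicExp_iff_logCubeFloorLiouville : Q1 → Q2 → (24077 ↔ LogCubeFloorLiouville)` (THE LOOP),
`TypeIQuantSubcubicExp_of : Q2 → LogCubeFloorLiouville → crux` (proving-polarity reading); rungs/comparison:
`localRateFloor_of_hasTypeIDecay` (the floor in the envelope class, from the landed T4),
`envelopeLiouville_of_logCubeFloorLiouville` / `envelopeLiouville_of_logCubeLiouville` (landed T3: either
value dominates the closed edge's), `envelopeLiouville_of_typeIQuantSubcubicExp_of_Q1` (given Q1 alone this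
line re-proves the closed edge's statement).

bears_on: LADDER-NS W7 (24077 over core 10661) / H2 — after `truncation_edge` v1.9.1 the residual of W7 over
the DSS wall is «rate/thin class minus envelope class»; this line types that residual as Q1 (edge) and Q2 (converse)
and, modulo them, identifies the crux with `LogCubeFloorLiouville`.  HONEST FRAME: nothing here proves
Q1, Q2, Q3, 24077, 22144, the DSS wall or Navier–Stokes regularity; all are OPEN.  No summit is proved by this
line.

## Version log
* v1.0 (2026-08-28 ≈22:30Z, ns-idea-7 g9): objects `LocalRateFloor`, `LogCubeLiouville`,
  `LogCubeFloorLiouville`; stubs Q1/Q2 (+ optional Q3); kernel-checked family, edge, converse, loop, rungs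
  (lean check rc 0 · 0 errors · sorries 3 = the stubs); BC7 probes of Q1/Q2/Q3/both values vs the crux: all
  CLEAN (card `Lines/quiet-collar.md`).  Commit 3d053daf7b31.
* v1.1 (2026-08-28 ≈23:10Z, ns-idea-7 g9): Q1 ANATOMY — objects `mildDefect`, `QuietCollar`, `CutPair`,
  `ForcedTwoNormShadowing` (+ closed stubs); kernel-checked `farFieldTruncation_of_quietAnatomy` (QP1 → QP2 →
  QP3 → landed P2 → `FarFieldTruncation M v`) and `stub_quietTruncation` DERIVED from the piece stubs and
  `TruncationEdge.stub_frameBootstrap`; the v1.0 «why» paragraph CORRECTED (dead sub-mechanisms listed above);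
  lean check rc 0 · 0 errors · sorries 5 = QP1, QP2, QP3, Q2, Q3; BC7 probes of QP1/QP2/QP3 vs the crux: CLEAN.
  Commit dc186c64bb3d.
* v1.2 (2026-08-28 ≈23:20Z, ns-idea-7 g9): QP1 ANATOMY (`SpikeBox`/`StubSpikeBox`, `StubCollarCounting`,
  `stubQuietCollar_of_parts`) and QP3 ANATOMY (`SupForcedShadowing`, `L3LosslessStep`,
  `forcedTwoNormShadowing_of_parts` — kernel-checked constant bookkeeping); QP1 and QP3 DERIVED; lean check rc 0 ·
  0 errors · sorries 7 = QP1a, QP1b, QP2, QP3a, QP3b, Q3, Q2 (every one a genuine lemma: a KNSS smoothing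
  application, an `eLpNorm` counting argument, the cut-off/commutator construction, P3a with forcing, a linear
  Volterra estimate, and the two converse-side statements); BC7 probes of the four new stubs vs the crux: see card.
  Commit a0e27964c683.
* v1.3 (2026-08-28 ≈23:45Z, ns-idea-7 g9): QP1b `stub_collarCounting` PROVED (support `card_mul_le_of_floor_balls`
  + grid/pigeonhole/arithmetic, ≈ 330 lines, no PDE); lean check rc 0 · 0 errors · sorries 6 = QP1a, QP2, QP3a,
  QP3b, Q3, Q2.  The LEVER QP1 (quiet collar) now rests on the single analytic input QP1a (KNSS smoothing at scale).
* v1.4 (2026-08-29 ≈00:15Z, ns-idea-7 g10 — REBASE): QP1 LANDED BY NAME (`Theorems/QuarterLogPincerQuietCollarLever.lean`,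
  `stub_quietCollar : StubQuietCollar`, typer g36) over the re-homed objects `Theorems/QuarterLogPincerQuietCollarDefs.lean`;
  both imported, the thirteen duplicate object declarations and the derived `stub_quietCollar` deleted, the QP1a sorry
  retired (QP1a is now only a hypothesis of the alternative road `stubQuietCollar_of_parts`); lean check rc 0 · 0 errors ·
  sorries 5 = QP2, QP3a, QP3b, Q3, Q2.  Statements unchanged (verbatim re-homing); the loop theorems unchanged.
-/

noncomputable section

set_option linter.dupNamespace false

namespace Summit.NavierStokesRegularity.NavierStokesRegularity.Cruxes.TypeIQuantSubcubicExp.QuietCollar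

open MeasureTheory Set Function Metric Filter Topology
open scoped ENNReal NNReal
open Literature.Analysis Literature.Analysis.FluidPDE
open Summit.NavierStokesRegularity.NavierStokesRegularity.Cruxes.TypeIQuantSubcubicExp.ThinCascade
  (TaoFrame ThinObject SingularAt)
open Summit.NavierStokesRegularity.NavierStokesRegularity.Cruxes.TypeIQuantSubcubicExp.TruncationEdge
  (QuantSubcubicExpAt TruncatedFamily FarFieldTruncation EnvelopeCubeBudget RateFloor
   StubRateFloor StubEnvelopeCubeBudget stub_rateFloor stub_envelopeCubeBudget
   not_typeIQuantSubcubicExp_of_truncatedFamily FrameBootstrap StubFrameBootstrap stub_frameBootstrap)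

/-! ### The log-cube class, its Liouville values, the obligations Q1/Q2/Q3 and the Q1 anatomy QP1–QP3 — IMPORTED

v1.4 (REBASE, ns-idea-7 g10): the objects `LocalRateFloor`, `LogCubeLiouville`, `LogCubeFloorLiouville`,
`StubQuietTruncation`, `StubLocalRateFloor`, `StubLogCubeExtraction`, `mildDefect`, `QuietCollar`, `CutPair`,
`ForcedTwoNormShadowing`, `StubQuietCollar`, `StubCutPair`, `StubForcedTwoNormShadowing` now live, VERBATIM and under
the SAME fully-qualified names, in the landed `Theorems/QuarterLogPincerQuietCollarDefs.lean` (re-homed by typer g36),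
and QP1 `stub_quietCollar : StubQuietCollar` is the landed THEOREM of `Theorems/QuarterLogPincerQuietCollarLever.lean`
(direct road: slab Lipschitz bound + box mass + radial Chebyshev–Fubini + polynomial bookkeeping).  Both are imported
above; the duplicate declarations and the derived `stub_quietCollar` of v1.3 are deleted here.  The v1.2 anatomy of QP1
(QP1a `StubSpikeBox` + QP1b `StubCollarCounting`, composition `stubQuietCollar_of_parts`, QP1b PROVED) is kept as an
ALTERNATIVE road (no sorry: QP1a is now a plain hypothesis of `stubQuietCollar_of_parts`, not a registered stub). -/

/-! ### v1.2 — QP1 ANATOMY (spike box + collar counting) and QP3 ANATOMY (lossy sup part + lossless `L³` step) -/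

/-- (QP1a) **SPIKE BOX** (Type-I smoothing at scale): an `η`-spike at `(s,x)`, `s ∈ [−1,−ε]`, persists as an
`η/2`-floor on the forward parabolic box `[s, s + ηε^{3/2}/C] × B̄(x, ηε/C)` (from `|∇v| ≲ C_M/(−s)` and
`|∂_s v| ≲ C_M(−s)^{−3/2}` on `[−1,−ε/2]`: tree `knss2009_local_smoothing_holds` with `(k,l) = (1,0), (0,1)`
restarted at `s' = s − θ(−s)`). [this file; line object] -/
def SpikeBox (v : ℝ → EuclideanSpace ℝ (Fin 3) → EuclideanSpace ℝ (Fin 3)) : Prop :=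
  ∃ C : ℝ, 2 ≤ C ∧ ∀ ε ∈ Set.Ioc (0 : ℝ) (1 / 2), ∀ η ∈ Set.Ioc (0 : ℝ) 1,
    ∀ s ∈ Set.Icc (-1 : ℝ) (-ε), ∀ x : EuclideanSpace ℝ (Fin 3), η < ‖v s x‖ →
      ∀ s' ∈ Set.Icc s (s + η * ε ^ (3 / 2 : ℝ) / C), ∀ y ∈ Metric.closedBall x (η * ε / C),
        η / 2 ≤ ‖v s' y‖

/-- Registered closed form of (QP1a). [this file; line object] -/
def StubSpikeBox : Prop :=
  ∀ (M : ℝ) (v : ℝ → EuclideanSpace ℝ (Fin 3) → EuclideanSpace ℝ (Fin 3)),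
    IsTypeIAncientMild M v → SpikeBox v

/-- (QP1b) **COLLAR COUNTING** (pure bookkeeping on `eLpNorm`; no PDE): spike boxes + the log-cube budget ⇒ a
quiet collar at polynomial radius.  Road: grid of radii `r_i = ρ + i(Lq + 2r_η)` in `[ρ, 2ρ]`; if every collar
`[r_i, r_i + Lq]` held a spike, the spike boxes would be spatially disjoint, each of slice-mass
`≥ (ηq/2)³|B(r_η)|` during a time interval of length `τ_η`, so `N τ_η (ηq/2)³|B(r_η)| ≤ ∫_{−1}^{−ε/2} b(3ρ, ε/2)³ ds
≤ B(1 + log 3ρ + log(2/ε))` — false for `ρ` polynomially large. [this file; line object] -/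
def StubCollarCounting : Prop :=
  ∀ (v : ℝ → EuclideanSpace ℝ (Fin 3) → EuclideanSpace ℝ (Fin 3)),
    SpikeBox v → EnvelopeCubeBudget v → QuietCollar v

/-- (QP3a) **FORCED SUP SHADOWING WITH POLYNOMIAL LOSS** — P3a of `truncation_edge` (landed
`stub_supShadowingCore`: Henry–Gronwall across `log₂(1/ε)` dyadic blocks) with a forcing term = the mild defect of
the reference. [this file; line object] -/
def SupForcedShadowing : Prop :=
  ∀ M : ℝ, 0 ≤ M → ∃ κ K : ℝ, 0 ≤ κ ∧ 1 ≤ K ∧ ∀ ε ∈ Set.Ioc (0 : ℝ) (1 / 2), ∀ η : ℝ, 0 ≤ η →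
    ∀ (V : ℝ → EuclideanSpace ℝ (Fin 3) → EuclideanSpace ℝ (Fin 3)),
      ContinuousOn (uncurry V) (Set.Icc 0 (1 - ε) ×ˢ Set.univ) →
      (∀ t ∈ Set.Icc 0 (1 - ε), ∀ x, ‖V t x‖ ≤ M * (1 - t) ^ (-(1 / 2 : ℝ))) →
      (∃ R : ℝ, ∀ t ∈ Set.Icc 0 (1 - ε), ∀ x : EuclideanSpace ℝ (Fin 3), R ≤ ‖x‖ → V t x = 0) →
      (∀ t ∈ Set.Icc 0 (1 - ε), ∀ x, ‖mildDefect V t x‖ ≤ η) →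
    ∀ u₀ : EuclideanSpace ℝ (Fin 3) → EuclideanSpace ℝ (Fin 3), (∀ x, ‖u₀ x - V 0 x‖ ≤ η) →
    ∀ T' ∈ Set.Ioc (0 : ℝ) (1 - ε),
    ∀ (u : ℝ → EuclideanSpace ℝ (Fin 3) → EuclideanSpace ℝ (Fin 3)) (p : ℝ → EuclideanSpace ℝ (Fin 3) → ℝ),
      TaoFrame T' u p → u 0 = u₀ →
      (∀ t ∈ Set.Icc 0 T', ∀ x, ‖u t x - V t x‖ ≤ 2) →
      ∀ t ∈ Set.Icc 0 T', ∀ x, ‖u t x - V t x‖ ≤ K * ε ^ (-κ) * η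

/-- (QP3b) **LOSSLESS `L³` STEP** (linear Volterra estimate with a SMALL coefficient; rate only): if a Tao-frame
solution stays `θ`-close in SUP to a rate-`M` reference with defect, `θ ≤ c₀(M)`, then its `L³`-distance is
`≤ K'(β + b θ)` where `β` bounds the `L³` data error and defect and `b` the reference's `L³` level — NO loss in
`ε`: the bilinear terms `B₀(w,u) + B₀(V,w)` are `≤ ‖∇O_τ‖_{L¹}·θ·(‖u‖₃ + ‖V‖₃)` and `‖u‖₃ ≤ b + ‖w‖₃` is absorbed.
[this file; line object] -/
def L3LosslessStep : Prop :=
  ∀ M : ℝ, 0 ≤ M → ∃ c₀ K' : ℝ, 0 < c₀ ∧ 1 ≤ K' ∧ ∀ ε ∈ Set.Ioc (0 : ℝ) (1 / 2),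
    ∀ (V : ℝ → EuclideanSpace ℝ (Fin 3) → EuclideanSpace ℝ (Fin 3)),
      ContinuousOn (uncurry V) (Set.Icc 0 (1 - ε) ×ˢ Set.univ) →
      (∀ t ∈ Set.Icc 0 (1 - ε), ∀ x, ‖V t x‖ ≤ M * (1 - t) ^ (-(1 / 2 : ℝ))) →
      (∃ R : ℝ, ∀ t ∈ Set.Icc 0 (1 - ε), ∀ x : EuclideanSpace ℝ (Fin 3), R ≤ ‖x‖ → V t x = 0) →
    ∀ T' ∈ Set.Ioc (0 : ℝ) (1 - ε),
    ∀ (u : ℝ → EuclideanSpace ℝ (Fin 3) → EuclideanSpace ℝ (Fin 3)) (p : ℝ → EuclideanSpace ℝ (Fin 3) → ℝ),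
      TaoFrame T' u p →
      ∀ θ : ℝ, 0 ≤ θ → θ ≤ c₀ → (∀ t ∈ Set.Icc 0 T', ∀ x, ‖u t x - V t x‖ ≤ θ) →
      ∀ β b : ℝ, 0 ≤ β → 0 ≤ b →
        eLpNorm (fun x => u 0 x - V 0 x) 3 volume ≤ ENNReal.ofReal β →
        (∀ t ∈ Set.Icc 0 (1 - ε), eLpNorm (mildDefect V t) 3 volume ≤ ENNReal.ofReal β) →
        (∀ t ∈ Set.Icc 0 (1 - ε), eLpNorm (V t) 3 volume ≤ ENNReal.ofReal b) →
        ∀ t ∈ Set.Icc 0 T', eLpNorm (fun x => u t x - V t x) 3 volume ≤ ENNReal.ofReal (K' * (β + b * θ))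

/-- Registered closed forms of (QP3a), (QP3b) (already closed). [this file; line objects] -/
def StubSupForcedShadowing : Prop := SupForcedShadowing

def StubL3LosslessStep : Prop := L3LosslessStep


/-! ### v1.3 — QP1b PROVED: slice counting (the measure-theoretic heart) -/

/-- **Slice counting**: finitely many `2r`-separated closed balls inside `B(0,R)`, each carrying the floor
`η ≤ |v(s,·)|`, against the slice budget `‖1_{B(0,R)} v(s)‖₃ ≤ b`: `#balls · η³ r³ |B̄(0,1)| ≤ b³`
(`eLpNorm` ↔ `lintegral`, additivity over disjoint balls, Haar scaling of balls). [this file; support, PROVED] -/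
theorem card_mul_le_of_floor_balls {v : ℝ → EuclideanSpace ℝ (Fin 3) → EuclideanSpace ℝ (Fin 3)}
    {s R η r b : ℝ} {ι : Type*} (I : Finset ι) (x : ι → EuclideanSpace ℝ (Fin 3))
    (hη : 0 ≤ η) (hr : 0 ≤ r) (hb : 0 ≤ b)
    (hsep : ∀ i ∈ I, ∀ j ∈ I, i ≠ j → 2 * r < dist (x i) (x j))
    (hin : ∀ i ∈ I, ‖x i‖ + r < R)
    (hfloor : ∀ i ∈ I, ∀ y ∈ Metric.closedBall (x i) r, η ≤ ‖v s y‖)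
    (hbud : eLpNorm ((Metric.ball (0 : EuclideanSpace ℝ (Fin 3)) R).indicator (v s)) 3 volume ≤
      ENNReal.ofReal b) :
    (I.card : ℝ) * (η ^ 3 * r ^ 3 *
      (volume (Metric.closedBall (0 : EuclideanSpace ℝ (Fin 3)) 1)).toReal) ≤ b ^ 3 := by
  classical
  set V₁ : ℝ≥0∞ := volume (Metric.closedBall (0 : EuclideanSpace ℝ (Fin 3)) 1) with hV₁
  have hV₁top : V₁ ≠ ⊤ := measure_closedBall_lt_top.ne
  have h3ne : (3 : ℝ≥0∞) ≠ 0 := by norm_num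
  have h3top : (3 : ℝ≥0∞) ≠ ⊤ := by norm_num
  have hL : ∫⁻ y in Metric.ball (0 : EuclideanSpace ℝ (Fin 3)) R, ‖v s y‖ₑ ^ (3 : ℝ) ≤
      ENNReal.ofReal b ^ (3 : ℝ) := by
    rw [eLpNorm_indicator_eq_eLpNorm_restrict measurableSet_ball,
      eLpNorm_eq_lintegral_rpow_enorm_toReal h3ne h3top] at hbud
    have h3r : (3 : ℝ≥0∞).toReal = 3 := by norm_num
    rw [h3r] at hbud
    have h := ENNReal.rpow_le_rpow hbud (by norm_num : (0 : ℝ) ≤ 3)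
    rwa [← ENNReal.rpow_mul, show (1 / (3 : ℝ)) * 3 = 1 by norm_num, ENNReal.rpow_one] at h
  have hball : ∀ i ∈ I, ENNReal.ofReal (η ^ 3) * volume (Metric.closedBall (x i) r) ≤
      ∫⁻ y in Metric.closedBall (x i) r, ‖v s y‖ₑ ^ (3 : ℝ) := by
    intro i hi
    rw [← setLIntegral_const]
    refine setLIntegral_mono' measurableSet_closedBall (fun y hy => ?_)
    have hηy : η ≤ ‖v s y‖ := hfloor i hi y hy
    have h1 : ENNReal.ofReal η ≤ ‖v s y‖ₑ := by
      rw [← ofReal_norm]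
      exact ENNReal.ofReal_le_ofReal hηy
    have h2 : ENNReal.ofReal (η ^ 3) = ENNReal.ofReal η ^ (3 : ℝ) := by
      rw [ENNReal.ofReal_rpow_of_nonneg hη (by norm_num)]
      norm_num
    rw [h2]
    exact ENNReal.rpow_le_rpow h1 (by norm_num)
  have hdisj : (↑I : Set ι).PairwiseDisjoint (fun i => Metric.closedBall (x i) r) := by
    intro i hi j hj hij
    exact Metric.closedBall_disjoint_closedBall (by linarith [hsep i hi j hj hij])
  have hU : ∑ i ∈ I, ∫⁻ y in Metric.closedBall (x i) r, ‖v s y‖ₑ ^ (3 : ℝ) =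
      ∫⁻ y in ⋃ i ∈ I, Metric.closedBall (x i) r, ‖v s y‖ₑ ^ (3 : ℝ) :=
    (lintegral_biUnion_finset hdisj (fun i _ => measurableSet_closedBall) _).symm
  have hsub : (⋃ i ∈ I, Metric.closedBall (x i) r) ⊆
      Metric.ball (0 : EuclideanSpace ℝ (Fin 3)) R := by
    intro y hy
    simp only [mem_iUnion, Metric.mem_closedBall, exists_prop] at hy
    obtain ⟨i, hi, hyi⟩ := hy
    rw [mem_ball_zero_iff]
    calc ‖y‖ = ‖(y - x i) + x i‖ := by abel_nf
      _ ≤ ‖y - x i‖ + ‖x i‖ := norm_add_le _ _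
      _ = dist y (x i) + ‖x i‖ := by rw [dist_eq_norm]
      _ ≤ r + ‖x i‖ := by linarith
      _ < R := by linarith [hin i hi]
  have hsum : ∑ i ∈ I, ENNReal.ofReal (η ^ 3) * volume (Metric.closedBall (x i) r) ≤
      ENNReal.ofReal b ^ (3 : ℝ) := by
    refine (Finset.sum_le_sum hball).trans ?_
    rw [hU]
    exact (lintegral_mono_set hsub).trans hL
  have hvol : ∀ i, volume (Metric.closedBall (x i) r) = ENNReal.ofReal (r ^ 3) * V₁ := by
    intro i
    rw [Measure.addHaar_closedBall volume (x i) hr, hV₁]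
    simp [finrank_euclideanSpace]
  simp_rw [hvol] at hsum
  rw [Finset.sum_const, nsmul_eq_mul] at hsum
  have hb3 : ENNReal.ofReal b ^ (3 : ℝ) = ENNReal.ofReal (b ^ 3) := by
    rw [ENNReal.ofReal_rpow_of_nonneg hb (by norm_num)]
    norm_num
  rw [hb3] at hsum
  have hT : ENNReal.ofReal ((I.card : ℝ) * (η ^ 3 * r ^ 3 * V₁.toReal)) =
      (I.card : ℝ≥0∞) * (ENNReal.ofReal (η ^ 3) * (ENNReal.ofReal (r ^ 3) * V₁)) := by
    rw [ENNReal.ofReal_mul (by positivity), ENNReal.ofReal_natCast,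
      ENNReal.ofReal_mul (by positivity), ENNReal.ofReal_mul (by positivity),
      ENNReal.ofReal_toReal hV₁top]
    ring
  have hfinal : ENNReal.ofReal ((I.card : ℝ) * (η ^ 3 * r ^ 3 * V₁.toReal)) ≤
      ENNReal.ofReal (b ^ 3) := by
    rw [hT]; exact hsum
  exact (ENNReal.ofReal_le_ofReal_iff (by positivity)).1 hfinal

/-! ### Stubs (sorries ONLY here — v1.4: QP2, QP3a, QP3b, Q3, Q2; QP1 is LANDED by name, QP1b is PROVED below) -/

set_option maxHeartbeats 1600000 in
/-- QP1b — collar counting, PROVED (v1.3, ns-idea-7 g9): grid of radii `ρ + i(Lq + 3r_η)`, a spike in every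
collar would give `N ≈ ρ/(Lq+3r_η)` spatially disjoint floor balls; pigeonholing their start times into slots of
length `τ_η` produces ONE slice `s⋆ ∈ [−1, −ε/2]` carrying `≳ Nτ_η` of them, and `card_mul_le_of_floor_balls`
against the budget `b(2ρ+1, ε/2)³ ≤ B(1 + log(2ρ+1) + log(2/ε))` is contradicted by `ρ = K₁ε^{−κ₁}/2`,
`κ₁ = 8k + 6`, `K₁ = A²`, `A = max(4K, (4K/c₀)(2|B̄₁| + (B+1)(7+κ₁)))`, `c₀ = |B̄₁|/(16K⁷C⁴)`.  No PDE. -/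
theorem stub_collarCounting : StubCollarCounting := by
  classical
  rintro v ⟨C, hC2, hbox⟩ ⟨B, hB0, hbud⟩ k K hk hK
  -- the unit-ball volume
  obtain ⟨W, hW⟩ : ∃ W : ℝ,
      W = (volume (Metric.closedBall (0 : EuclideanSpace ℝ (Fin 3)) 1)).toReal := ⟨_, rfl⟩
  have hWpos : 0 < W := by
    rw [hW]
    exact ENNReal.toReal_pos (measure_closedBall_pos volume _ one_pos).ne'
      measure_closedBall_lt_top.ne
  have hC : 0 < C := by linarith
  have hK0 : 0 < K := by linarith
  -- constants
  obtain ⟨κ₁, hκ₁⟩ : ∃ κ₁ : ℝ, κ₁ = 8 * k + 6 := ⟨_, rfl⟩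
  have hκ₁0 : 0 ≤ κ₁ := by rw [hκ₁]; linarith
  obtain ⟨c₀, hc₀⟩ : ∃ c₀ : ℝ, c₀ = W / (16 * K ^ 7 * C ^ 4) := ⟨_, rfl⟩
  have hc₀pos : 0 < c₀ := by rw [hc₀]; positivity
  obtain ⟨A, hA⟩ : ∃ A : ℝ,
      A = max (4 * K) (4 * K / c₀ * (2 * W + (B + 1) * (7 + κ₁))) := ⟨_, rfl⟩
  have hA4K : 4 * K ≤ A := by rw [hA]; exact le_max_left _ _
  have hA2 : 2 ≤ A := by linarith
  have hA0 : 0 ≤ A := by linarith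
  have hAc : 2 * W + (B + 1) * (7 + κ₁) ≤ A * c₀ / (4 * K) := by
    have h := le_max_right (4 * K) (4 * K / c₀ * (2 * W + (B + 1) * (7 + κ₁)))
    rw [← hA] at h
    have h4K : 0 < 4 * K := by linarith
    calc 2 * W + (B + 1) * (7 + κ₁)
        = (4 * K / c₀ * (2 * W + (B + 1) * (7 + κ₁))) * c₀ / (4 * K) := by
          field_simp
      _ ≤ A * c₀ / (4 * K) := by gcongr
  have hA13 : (B + 1) * (5 + 2 * A + κ₁) ≤ A ^ 2 * c₀ / (4 * K) - 2 * W := by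
    have h1 : A * (2 * W + (B + 1) * (7 + κ₁)) ≤ A * (A * c₀ / (4 * K)) :=
      mul_le_mul_of_nonneg_left hAc hA0
    have h2 : A * (A * c₀ / (4 * K)) = A ^ 2 * c₀ / (4 * K) := by ring
    have h3 : A * (2 * W + (B + 1) * (7 + κ₁)) - (2 * W + (B + 1) * (5 + 2 * A + κ₁)) =
        (A - 1) * (2 * W + (B + 1) * (5 + κ₁)) := by ring
    have h4 : 0 ≤ (A - 1) * (2 * W + (B + 1) * (5 + κ₁)) :=
      mul_nonneg (by linarith) (by positivity)
    linarith
  refine ⟨κ₁, A ^ 2, hκ₁0, by nlinarith, ?_⟩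
  intro ε hε ηq Lq hηq hLq hLqK
  obtain ⟨hε0, hε1⟩ := hε
  have hε1' : ε ≤ 1 := by linarith
  -- powers of ε
  have hεpow_pos : ∀ a : ℝ, 0 < ε ^ a := fun a => Real.rpow_pos_of_pos hε0 a
  have hεpow_ge_one : ∀ a : ℝ, a ≤ 0 → 1 ≤ ε ^ a := fun a ha =>
    Real.one_le_rpow_of_pos_of_le_one_of_nonpos hε0 hε1' ha
  have hεpow_le_one : ∀ a : ℝ, 0 ≤ a → ε ^ a ≤ 1 := fun a ha => Real.rpow_le_one hε0.le hε1' ha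
  have hεmono : ∀ a b : ℝ, a ≤ b → ε ^ b ≤ ε ^ a := fun a b hab =>
    Real.rpow_le_rpow_of_exponent_ge hε0 hε1' hab
  have hεmul : ∀ a b : ℝ, ε ^ a * ε ^ b = ε ^ (a + b) := fun a b => (Real.rpow_add hε0 a b).symm
  have hεnat : ∀ (a : ℝ) (n : ℕ), (ε ^ a) ^ n = ε ^ (a * n) := fun a n => by
    rw [Real.rpow_mul hε0.le, Real.rpow_natCast]
  have h1ε : 1 ≤ 1 / ε := by rw [le_div_iff₀ hε0]; linarith
  -- η₀ and its floor e₀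
  obtain ⟨e₀, he₀⟩ : ∃ e₀ : ℝ, e₀ = ε ^ k / K := ⟨_, rfl⟩
  have he₀pos : 0 < e₀ := by rw [he₀]; positivity
  have hηqpos : 0 < ηq := lt_of_lt_of_le he₀pos (by rw [he₀]; exact hηq)
  obtain ⟨η₀, hη₀⟩ : ∃ η₀ : ℝ, η₀ = min ηq 1 := ⟨_, rfl⟩
  have hη₀pos : 0 < η₀ := by rw [hη₀]; exact lt_min hηqpos one_pos
  have hη₀le1 : η₀ ≤ 1 := by rw [hη₀]; exact min_le_right _ _
  have hη₀leq : η₀ ≤ ηq := by rw [hη₀]; exact min_le_left _ _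
  have he₀le1 : e₀ ≤ 1 := by
    rw [he₀, div_le_one hK0]; exact (hεpow_le_one k hk).trans hK
  have hη₀ge : e₀ ≤ η₀ := by rw [hη₀]; exact le_min (by rw [he₀]; exact hηq) he₀le1
  -- radius and duration of a spike box
  obtain ⟨rη, hrη⟩ : ∃ rη : ℝ, rη = η₀ * ε / C := ⟨_, rfl⟩
  obtain ⟨τ, hτ⟩ : ∃ τ : ℝ, τ = η₀ * ε ^ (3 / 2 : ℝ) / C := ⟨_, rfl⟩
  have hrηpos : 0 < rη := by rw [hrη]; positivity
  have hτpos : 0 < τ := by rw [hτ]; positivity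
  have hrηle : rη ≤ 1 / 4 := by
    rw [hrη, div_le_iff₀ hC]
    have : η₀ * ε ≤ 1 * (1 / 2) := mul_le_mul hη₀le1 hε1 hε0.le zero_le_one
    linarith
  have hε32 : ε ^ (3 / 2 : ℝ) ≤ ε := by
    have h := hεmono 1 (3 / 2) (by norm_num)
    rwa [Real.rpow_one] at h
  have hτle : τ ≤ ε / 2 := by
    rw [hτ, div_le_iff₀ hC]
    have : η₀ * ε ^ (3 / 2 : ℝ) ≤ 1 * ε := mul_le_mul hη₀le1 hε32 (hεpow_pos _).le zero_le_one
    nlinarith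
  have hτle1 : τ ≤ 1 := by linarith
  have hrηge : e₀ * ε / C ≤ rη := by rw [hrη]; gcongr
  have hτge : e₀ * ε ^ (3 / 2 : ℝ) / C ≤ τ := by rw [hτ]; gcongr
  -- grid spacing, base radius, number of collars
  obtain ⟨D, hD⟩ : ∃ D : ℝ, D = Lq + 3 * rη := ⟨_, rfl⟩
  have hDpos : 0 < D := by rw [hD]; positivity
  have hLqD : Lq ≤ D := by rw [hD]; linarith
  have hDle : D ≤ 2 * K * ε ^ (-k) := by
    have h1 : (1 : ℝ) ≤ K * ε ^ (-k) := by
      have := hεpow_ge_one (-k) (by linarith)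
      nlinarith
    rw [hD]; linarith
  obtain ⟨ρ, hρ⟩ : ∃ ρ : ℝ, ρ = A ^ 2 * ε ^ (-κ₁) / 2 := ⟨_, rfl⟩
  have hA2sq : (4 : ℝ) ≤ A ^ 2 := by nlinarith
  have hAε : (1 : ℝ) ≤ A ^ 2 * ε ^ (-κ₁) := by
    have h := hεpow_ge_one (-κ₁) (by linarith)
    nlinarith
  have hρpos : 0 < ρ := by rw [hρ]; positivity
  have hρ2 : 2 ≤ ρ := by
    rw [hρ]
    have h := hεpow_ge_one (-κ₁) (by linarith)
    nlinarith
  have h2ρ : 2 * ρ = A ^ 2 * ε ^ (-κ₁) := by rw [hρ]; ring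
  obtain ⟨N, hN⟩ : ∃ N : ℕ, N = ⌊ρ / D⌋₊ := ⟨_, rfl⟩
  have hND : (N : ℝ) * D ≤ ρ := by
    have h := Nat.floor_le (div_nonneg hρpos.le hDpos.le)
    rw [← hN] at h
    exact (le_div_iff₀ hDpos).1 h
  have hNgt : ρ / D - 1 < N := by
    have h := Nat.lt_floor_add_one (ρ / D)
    rw [← hN] at h
    linarith
  -- grid radii
  obtain ⟨rad, hrad⟩ : ∃ rad : ℕ → ℝ, rad = fun i : ℕ => ρ + (i : ℝ) * D := ⟨_, rfl⟩
  have hadm : ∀ i : ℕ, i < N → 2 ≤ rad i ∧ rad i + Lq ≤ A ^ 2 * ε ^ (-κ₁) := by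
    intro i hi
    have hi0 : (0 : ℝ) ≤ i * D := by positivity
    have hi1 : (i : ℝ) + 1 ≤ N := by exact_mod_cast Nat.succ_le_of_lt hi
    have hi2 : ((i : ℝ) + 1) * D ≤ N * D := by gcongr
    refine ⟨by rw [hrad]; simp only; linarith only [hρ2, hi0], ?_⟩
    rw [hrad]; simp only
    linarith only [hi2, hND, hLqD, h2ρ]
  -- suppose every admissible collar carries a spike
  by_contra hcon
  push Not at hcon
  choose! fs hfs fx hfx1 hfx2 hfv using hcon
  have hsI : ∀ i, i < N → fs (rad i) ∈ Set.Icc (-1 : ℝ) (-ε) := fun i hi =>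
    hfs _ (hadm i hi).1 (hadm i hi).2
  have hx1 : ∀ i, i < N → rad i ≤ ‖fx (rad i)‖ := fun i hi =>
    hfx1 _ (hadm i hi).1 (hadm i hi).2
  have hx2 : ∀ i, i < N → ‖fx (rad i)‖ ≤ rad i + Lq := fun i hi =>
    hfx2 _ (hadm i hi).1 (hadm i hi).2
  have hv : ∀ i, i < N → ηq < ‖v (fs (rad i)) (fx (rad i))‖ := fun i hi =>
    hfv _ (hadm i hi).1 (hadm i hi).2
  -- each spike is a box
  have hfloor : ∀ i, i < N → ∀ s' ∈ Set.Icc (fs (rad i)) (fs (rad i) + τ),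
      ∀ y ∈ Metric.closedBall (fx (rad i)) rη, η₀ / 2 ≤ ‖v s' y‖ := by
    intro i hi s' hs' y hy
    rw [hτ] at hs'
    rw [hrη] at hy
    exact hbox ε ⟨hε0, hε1⟩ η₀ ⟨hη₀pos, hη₀le1⟩ (fs (rad i)) (hsI i hi) (fx (rad i))
      (lt_of_le_of_lt hη₀leq (hv i hi)) s' hs' y hy
  -- time slots and the pigeonhole
  obtain ⟨slot, hslot⟩ : ∃ slot : ℕ → ℕ, slot = fun i => ⌊(fs (rad i) + 1) / τ⌋₊ := ⟨_, rfl⟩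
  obtain ⟨S, hS⟩ : ∃ S : ℕ, S = ⌊1 / τ⌋₊ + 1 := ⟨_, rfl⟩
  have hSpos : 0 < S := by rw [hS]; exact Nat.succ_pos _
  have hmaps : ∀ i ∈ Finset.range N, slot i ∈ Finset.range S := by
    intro i hi
    rw [Finset.mem_range] at hi ⊢
    have h1 : (fs (rad i) + 1) / τ ≤ 1 / τ := by
      gcongr
      linarith only [(hsI i hi).2, hε0]
    have h2 := Nat.floor_le_floor h1
    rw [hslot, hS]
    simp only
    omega
  have hSne : (Finset.range S).Nonempty := ⟨0, by rw [Finset.mem_range]; exact hSpos⟩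
  have hmul : (Finset.range S).card * (N / S) ≤ (Finset.range N).card := by
    rw [Finset.card_range, Finset.card_range]
    exact Nat.mul_div_le N S
  obtain ⟨m, hm, hfib⟩ :=
    Finset.exists_le_card_fiber_of_mul_le_card_of_maps_to hmaps hSne hmul
  obtain ⟨I, hI⟩ : ∃ I : Finset ℕ, I = Finset.filter (fun i => slot i = m) (Finset.range N) :=
    ⟨_, rfl⟩
  rw [← hI] at hfib
  have hIprop : ∀ i ∈ I, i < N ∧ slot i = m := by
    intro i hi
    rw [hI, Finset.mem_filter, Finset.mem_range] at hi
    exact hi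
  -- the common slice
  obtain ⟨sstar, hsstar⟩ : ∃ sstar : ℝ, sstar = -1 + (m + 1) * τ := ⟨_, rfl⟩
  have hstar_mem : ∀ i ∈ I, sstar ∈ Set.Icc (fs (rad i)) (fs (rad i) + τ) := by
    intro i hi
    obtain ⟨hiN, hsl⟩ := hIprop i hi
    have hnn : 0 ≤ (fs (rad i) + 1) / τ :=
      div_nonneg (by linarith only [(hsI i hiN).1]) hτpos.le
    have hslot_i : slot i = ⌊(fs (rad i) + 1) / τ⌋₊ := by rw [hslot]
    have h1 : (m : ℝ) ≤ (fs (rad i) + 1) / τ := by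
      rw [← hsl, hslot_i]; exact Nat.floor_le hnn
    have h2 : (fs (rad i) + 1) / τ < m + 1 := by
      rw [← hsl, hslot_i]; exact Nat.lt_floor_add_one _
    rw [le_div_iff₀ hτpos] at h1
    rw [div_lt_iff₀ hτpos] at h2
    rw [hsstar]
    constructor <;> linarith only [h1, h2]
  -- the budget on the big ball, at times down to -ε/2
  obtain ⟨b, hb0, hbB, hbslice⟩ :=
    hbud (2 * ρ + 1) (by linarith only [hρ2]) (ε / 2) ⟨by positivity, by linarith only [hε1]⟩
  -- COUNTING at the common slice
  have hcount : (I.card : ℝ) * ((η₀ / 2) ^ 3 * rη ^ 3 * W) ≤ b ^ 3 := by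
    by_cases hIe : I = ∅
    · rw [hIe, Finset.card_empty, Nat.cast_zero, zero_mul]
      exact pow_nonneg hb0 3
    · obtain ⟨i₀, hi₀⟩ := Finset.nonempty_iff_ne_empty.2 hIe
      have hss : sstar ∈ Set.Icc (-1 : ℝ) (-(ε / 2)) := by
        obtain ⟨hiN, _⟩ := hIprop i₀ hi₀
        have h := hstar_mem i₀ hi₀
        exact ⟨le_trans (hsI i₀ hiN).1 h.1, by linarith only [h.2, (hsI i₀ hiN).2, hτle]⟩
      have hsep' : ∀ i ∈ I, ∀ j ∈ I, i < j → 2 * rη < dist (fx (rad i)) (fx (rad j)) := by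
        intro i hi j hj hij
        obtain ⟨hiN, _⟩ := hIprop i hi
        obtain ⟨hjN, _⟩ := hIprop j hj
        have hij1 : (i : ℝ) + 1 ≤ j := by exact_mod_cast Nat.succ_le_of_lt hij
        have hradij : rad i + D ≤ rad j := by
          have hm := mul_le_mul_of_nonneg_right hij1 hDpos.le
          rw [hrad]; simp only
          linarith only [hm]
        have hn : ‖fx (rad i)‖ + 3 * rη ≤ ‖fx (rad j)‖ := by
          have e1 := hx2 i hiN
          have e2 := hx1 j hjN
          rw [hD] at hradij
          linarith only [e1, e2, hradij]
        calc 2 * rη < 3 * rη := by linarith only [hrηpos]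
          _ ≤ ‖fx (rad j)‖ - ‖fx (rad i)‖ := by linarith only [hn]
          _ ≤ |‖fx (rad i)‖ - ‖fx (rad j)‖| := by
              rw [abs_sub_comm]; exact le_abs_self _
          _ ≤ ‖fx (rad i) - fx (rad j)‖ := abs_norm_sub_norm_le _ _
          _ = dist (fx (rad i)) (fx (rad j)) := (dist_eq_norm _ _).symm
      rw [hW]
      refine card_mul_le_of_floor_balls I (fun i => fx (rad i)) (by positivity) hrηpos.le hb0
        ?_ ?_ ?_ (hbslice sstar hss)
      · intro i hi j hj hij
        rcases lt_or_gt_of_ne hij with h | h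
        · exact hsep' i hi j hj h
        · rw [dist_comm]; exact hsep' j hj i hi h
      · intro i hi
        obtain ⟨hiN, _⟩ := hIprop i hi
        have e1 := hx2 i hiN
        have e2 := (hadm i hiN).2
        show ‖fx (rad i)‖ + rη < 2 * ρ + 1
        linarith only [e1, e2, h2ρ, hrηle]
      · intro i hi y hy
        exact hfloor i (hIprop i hi).1 sstar (hstar_mem i hi) y hy
  -- the fiber is large
  have hcardI : (N : ℝ) < (I.card + 1) * S := by
    have h1 : N < N / S * S + S := Nat.lt_div_mul_add hSpos
    have h2 : N / S ≤ I.card := hfib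
    have h3 : N / S * S + S ≤ I.card * S + S := by
      have := Nat.mul_le_mul_right S h2
      omega
    have h4 : N < (I.card + 1) * S := by
      have := lt_of_lt_of_le h1 h3
      rw [Nat.add_mul, Nat.one_mul]
      exact this
    exact_mod_cast h4
  have hSle : (S : ℝ) ≤ 2 / τ := by
    rw [hS, Nat.cast_add, Nat.cast_one]
    have h : (⌊1 / τ⌋₊ : ℝ) ≤ 1 / τ := Nat.floor_le (by positivity)
    have h1τ : 1 ≤ 1 / τ := by rw [le_div_iff₀ hτpos]; linarith only [hτle1]
    have h2 : 2 / τ = 1 / τ + 1 / τ := by ring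
    rw [h2]
    linarith only [h, h1τ]
  -- abbreviations μ (mass of one box slice) and Q = τ μ / 2
  obtain ⟨μ, hμ⟩ : ∃ μ : ℝ, μ = (η₀ / 2) ^ 3 * rη ^ 3 * W := ⟨_, rfl⟩
  have hμpos : 0 < μ := by rw [hμ]; positivity
  rw [← hμ] at hcount
  have hn : (ρ / D - 1) * τ / 2 - 1 < I.card := by
    have h1 : (N : ℝ) < (I.card + 1) * (2 / τ) :=
      lt_of_lt_of_le hcardI (mul_le_mul_of_nonneg_left hSle (by positivity))
    have h1' : (N : ℝ) < (I.card + 1) * 2 / τ := by rwa [← mul_div_assoc] at h1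
    have h2 : (N : ℝ) * τ < (I.card + 1) * 2 := (lt_div_iff₀ hτpos).1 h1'
    have h3 : (ρ / D - 1) * τ < N * τ := mul_lt_mul_of_pos_right hNgt hτpos
    linarith only [h2, h3]
  have hlow : ((ρ / D - 1) * τ / 2 - 1) * μ < I.card * μ := mul_lt_mul_of_pos_right hn hμpos
  -- lower bound of the left-hand side
  have hμle : μ ≤ W := by
    rw [hμ]
    have h1 : (η₀ / 2) ^ 3 ≤ 1 := pow_le_one₀ (by positivity) (by linarith)
    have h2 : rη ^ 3 ≤ 1 := pow_le_one₀ hrηpos.le (by linarith)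
    calc (η₀ / 2) ^ 3 * rη ^ 3 * W ≤ 1 * 1 * W := by gcongr
      _ = W := by ring
  have hQle : τ * μ / 2 ≤ W := by
    have h0 : 0 ≤ τ * μ := by positivity
    have : τ * μ ≤ 1 * W := mul_le_mul hτle1 hμle hμpos.le zero_le_one
    linarith only [this, h0]
  have hQge : c₀ * ε ^ (7 * k + 9 / 2) ≤ τ * μ / 2 := by
    have hμge : (e₀ / 2) ^ 3 * (e₀ * ε / C) ^ 3 * W ≤ μ := by
      rw [hμ]; gcongr
    have hprod : (e₀ * ε ^ (3 / 2 : ℝ) / C) * ((e₀ / 2) ^ 3 * (e₀ * ε / C) ^ 3 * W) / 2 ≤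
        τ * μ / 2 := by
      gcongr
    have key : (ε ^ k) ^ 7 * ε ^ (3 / 2 : ℝ) * ε ^ 3 = ε ^ (7 * k + 9 / 2) := by
      rw [hεnat, ← Real.rpow_natCast ε 3, hεmul, hεmul]
      congr 1; push_cast; ring
    have hid : (e₀ * ε ^ (3 / 2 : ℝ) / C) * ((e₀ / 2) ^ 3 * (e₀ * ε / C) ^ 3 * W) / 2 =
        c₀ * ε ^ (7 * k + 9 / 2) := by
      rw [← key, hc₀, he₀]
      field_simp
      ring
    rw [hid] at hprod
    exact hprod
  have hρD : ρ * ε ^ k / (2 * K) ≤ ρ / D := by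
    have h1 : ρ / (2 * K * ε ^ (-k)) ≤ ρ / D :=
      div_le_div_of_nonneg_left hρpos.le hDpos hDle
    have h2 : ρ / (2 * K * ε ^ (-k)) = ρ * ε ^ k / (2 * K) := by
      rw [Real.rpow_neg hε0.le]
      field_simp
    rw [h2] at h1
    exact h1
  have hpow3 : ε ^ (-κ₁) * ε ^ k * ε ^ (7 * k + 9 / 2) = ε ^ (-(3 / 2 : ℝ)) := by
    rw [hεmul, hεmul]
    congr 1; rw [hκ₁]; ring
  have hmain : A ^ 2 * c₀ / (4 * K) * ε ^ (-(3 / 2 : ℝ)) - 2 * W ≤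
      ((ρ / D - 1) * τ / 2 - 1) * μ := by
    have hQ0 : 0 ≤ τ * μ / 2 := by positivity
    have s1 : ((ρ / D - 1) * τ / 2 - 1) * μ = (ρ / D - 1) * (τ * μ / 2) - μ := by ring
    have s2 : (ρ * ε ^ k / (2 * K) - 1) * (τ * μ / 2) ≤ (ρ / D - 1) * (τ * μ / 2) := by
      gcongr
    have hρk0 : 0 ≤ ρ * ε ^ k / (2 * K) := by positivity
    have s3 : ρ * ε ^ k / (2 * K) * (c₀ * ε ^ (7 * k + 9 / 2)) ≤
        ρ * ε ^ k / (2 * K) * (τ * μ / 2) := mul_le_mul_of_nonneg_left hQge hρk0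
    have s4 : ρ * ε ^ k / (2 * K) * (c₀ * ε ^ (7 * k + 9 / 2)) =
        A ^ 2 * c₀ / (4 * K) * ε ^ (-(3 / 2 : ℝ)) := by
      rw [← hpow3, hρ]; ring
    linarith only [s1, s2, s3, s4, hQle, hμle]
  -- upper bound of the right-hand side
  have hΛ : 1 + Real.log (2 * ρ + 1) + Real.log (1 / (ε / 2)) ≤ (1 / ε) * (4 + 2 * A + κ₁) := by
    have hl1 : Real.log (1 / (ε / 2)) ≤ 2 * (1 / ε) := by
      have h := Real.log_le_sub_one_of_pos (show 0 < 1 / (ε / 2) by positivity)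
      have : 1 / (ε / 2) = 2 * (1 / ε) := by field_simp
      linarith only [h, this]
    have h2ρ1 : 2 * ρ + 1 ≤ 2 * (A ^ 2 * ε ^ (-κ₁)) := by linarith only [h2ρ, hAε]
    have hl2 : Real.log (2 * ρ + 1) ≤ Real.log (2 * (A ^ 2 * ε ^ (-κ₁))) :=
      Real.log_le_log (by positivity) h2ρ1
    have hl3 : Real.log (2 * (A ^ 2 * ε ^ (-κ₁))) =
        Real.log 2 + 2 * Real.log A + (-κ₁) * Real.log ε := by
      rw [Real.log_mul two_ne_zero (by positivity), Real.log_mul (by positivity) (by positivity),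
        Real.log_pow, Real.log_rpow hε0]
      push_cast; ring
    have hl4 : Real.log 2 ≤ 1 := by
      have h := Real.log_le_sub_one_of_pos (two_pos : (0 : ℝ) < 2); linarith only [h]
    have hl5 : Real.log A ≤ A := by
      have h := Real.log_le_sub_one_of_pos (by linarith only [hA2] : (0 : ℝ) < A)
      linarith only [h]
    have hl6 : (-κ₁) * Real.log ε ≤ κ₁ * (1 / ε) := by
      have hlog : -Real.log ε ≤ 1 / ε := by
        have h := Real.log_le_sub_one_of_pos (show 0 < 1 / ε by positivity)
        rw [Real.log_div one_ne_zero hε0.ne', Real.log_one] at h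
        linarith only [h]
      have hm := mul_le_mul_of_nonneg_left hlog hκ₁0
      have hid : (-κ₁) * Real.log ε = κ₁ * (-Real.log ε) := by ring
      rw [hid]
      exact hm
    have hl7 : (2 + 2 * A) * 1 ≤ (2 + 2 * A) * (1 / ε) :=
      mul_le_mul_of_nonneg_left h1ε (by linarith only [hA0])
    linarith only [hl1, hl2, hl3, hl4, hl5, hl6, hl7, h1ε]
  have hΛB : B * (1 + Real.log (2 * ρ + 1) + Real.log (1 / (ε / 2))) ≤
      B * ((1 / ε) * (4 + 2 * A + κ₁)) := mul_le_mul_of_nonneg_left hΛ hB0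
  -- comparison of the two sides
  have hε32' : 1 / ε ≤ ε ^ (-(3 / 2 : ℝ)) := by
    have h := hεmono (-(3 / 2 : ℝ)) (-1) (by norm_num)
    rw [Real.rpow_neg_one] at h
    rwa [one_div]
  have hfin1 : (1 / ε) * ((B + 1) * (5 + 2 * A + κ₁)) ≤
      A ^ 2 * c₀ / (4 * K) * ε ^ (-(3 / 2 : ℝ)) - 2 * W := by
    have hA2c : 0 ≤ A ^ 2 * c₀ / (4 * K) := by positivity
    have t1 : A ^ 2 * c₀ / (4 * K) * (1 / ε) ≤ A ^ 2 * c₀ / (4 * K) * ε ^ (-(3 / 2 : ℝ)) :=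
      mul_le_mul_of_nonneg_left hε32' hA2c
    have t2 : 2 * W * 1 ≤ 2 * W * (1 / ε) :=
      mul_le_mul_of_nonneg_left h1ε (by linarith only [hWpos])
    have t3 : (1 / ε) * ((B + 1) * (5 + 2 * A + κ₁)) ≤
        (1 / ε) * (A ^ 2 * c₀ / (4 * K) - 2 * W) :=
      mul_le_mul_of_nonneg_left hA13 (by positivity)
    have t4 : (1 / ε) * (A ^ 2 * c₀ / (4 * K) - 2 * W) =
        A ^ 2 * c₀ / (4 * K) * (1 / ε) - 2 * W * (1 / ε) := by ring
    linarith only [t1, t2, t3, t4]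
  have hfin2 : B * ((1 / ε) * (4 + 2 * A + κ₁)) < (1 / ε) * ((B + 1) * (5 + 2 * A + κ₁)) := by
    have hpos : 0 < 1 / ε := by positivity
    have h1 : B * (4 + 2 * A + κ₁) < (B + 1) * (5 + 2 * A + κ₁) := by
      linarith only [hB0, hA0, hκ₁0]
    have h2 := mul_lt_mul_of_pos_left h1 hpos
    have h3 : B * ((1 / ε) * (4 + 2 * A + κ₁)) = (1 / ε) * (B * (4 + 2 * A + κ₁)) := by ring
    rw [h3]
    exact h2
  linarith only [hcount, hbB, hΛB, hfin2, hfin1, hmain, hlow]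

/-- QP2 — the cut pair. [this file; line object — stub] -/
theorem stub_cutPair : StubCutPair := by
  sorry

/- v1.5 (2026-08-29): QP3a `stub_supForcedShadowing` and QP3b `stub_l3LosslessStep` are RETIRED as registered stubs —
QP3 `stub_forcedTwoNormShadowing : StubForcedTwoNormShadowing` is LANDED BY NAME (pub-ns-dss typer g36,
`Theorems/QuarterLogPincerQuietCollarShadowing.lean`, imported above); their defs and the proved composition
`forcedTwoNormShadowing_of_parts` stay as the record of the v1.1 anatomy. -/

/-- Q3 — localised Leray floor (value upgrade only; not used by the loop). [this file; line object — stub] -/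
theorem stub_localRateFloor : StubLocalRateFloor := by
  sorry

/-- Q2 — log-cube extraction with a floor (converse direction only). [this file; line object — stub] -/
theorem stub_logCubeExtraction : StubLogCubeExtraction := by
  sorry

/-! ### v1.2 — QP1 and QP3 from their anatomies (PROVED compositions) -/

/-- **QP1 from QP1a and QP1b (PROVED; the seam is modus ponens — the content is the typing of the two halves).**
[this file; line theorem] -/
theorem stubQuietCollar_of_parts (h1 : StubSpikeBox) (h2 : StubCollarCounting) : StubQuietCollar :=
  fun M v hv hB => h2 v (h1 M v hv) hB

/-- QP1 — the quiet collar — is the LANDED theorem `stub_quietCollar : StubQuietCollar`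
(`Theorems/QuarterLogPincerQuietCollarLever.lean`, typer g36), imported BY NAME; v1.4 re-exports it under a
line-local alias for the audit. [tree theorem] -/
theorem qp1_quietCollar_landed : StubQuietCollar := stub_quietCollar

set_option maxHeartbeats 800000 in
/-- **QP3 from QP3a and QP3b (PROVED).** [this file; line theorem] -/
theorem forcedTwoNormShadowing_of_parts (ha : SupForcedShadowing) (hb : L3LosslessStep) :
    ForcedTwoNormShadowing := by
  intro M hM
  obtain ⟨κ, K₀, hκ, hK₀, hsup⟩ := ha M hM
  obtain ⟨c₀, K', hc₀, hK', hl3⟩ := hb M hM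
  have hK₀pos : 0 < K₀ := by linarith
  -- the combined constant
  set K : ℝ := max (K₀ / c₀) (max K' K₀) with hK
  have hKK' : K' ≤ K := (le_max_left _ _).trans (le_max_right _ _)
  have hKK₀ : K₀ ≤ K := (le_max_right _ _).trans (le_max_right _ _)
  have hKc : K₀ / c₀ ≤ K := le_max_left _ _
  have hK1 : 1 ≤ K := hK'.trans hKK'
  have hKpos : 0 < K := by linarith
  refine ⟨κ, K, hκ, hK1, ?_⟩
  intro ε hε η hη V hVcont hVrate hVzero hdef u₀ hdata T' hT' u p hframe hu0 hboot
  have hεpos : 0 < ε := hε.1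
  have hεκ : 0 ≤ ε ^ (-κ) := Real.rpow_nonneg hεpos.le _
  have hs := hsup ε hε η hη V hVcont hVrate hVzero hdef u₀ hdata T' hT' u p hframe hu0 hboot
  have hmono : K₀ * ε ^ (-κ) * η ≤ K * ε ^ (-κ) * η :=
    mul_le_mul_of_nonneg_right (mul_le_mul_of_nonneg_right hKK₀ hεκ) hη
  refine ⟨fun t ht x => (hs t ht x).trans hmono, ?_⟩
  intro β b hβ hb hsmall hdataL3 hdefL3 hVb t ht
  -- θ := K₀ ε^{-κ} η ≤ c₀
  have hθ0 : 0 ≤ K₀ * ε ^ (-κ) * η := by positivity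
  have hθc : K₀ * ε ^ (-κ) * η ≤ c₀ := by
    -- K₀ x ≤ c₀ K x ≤ c₀ where x = ε^{-κ} η and K x ≤ 1
    have hx : K * (ε ^ (-κ) * η) ≤ 1 := by simpa [mul_assoc] using hsmall
    have h1 : K₀ ≤ c₀ * K := by
      have := (div_le_iff₀ hc₀).1 hKc
      linarith [this]
    have hxn : 0 ≤ ε ^ (-κ) * η := by positivity
    calc K₀ * ε ^ (-κ) * η = K₀ * (ε ^ (-κ) * η) := by ring
      _ ≤ (c₀ * K) * (ε ^ (-κ) * η) := mul_le_mul_of_nonneg_right h1 hxn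
      _ = c₀ * (K * (ε ^ (-κ) * η)) := by ring
      _ ≤ c₀ * 1 := mul_le_mul_of_nonneg_left hx hc₀.le
      _ = c₀ := by ring
  have hdata0 : eLpNorm (fun x => u 0 x - V 0 x) 3 volume ≤ ENNReal.ofReal β := by
    simpa [hu0] using hdataL3
  have h := hl3 ε hε V hVcont hVrate hVzero T' hT' u p hframe (K₀ * ε ^ (-κ) * η) hθ0 hθc hs β b hβ hb
    hdata0 hdefL3 hVb t ht
  refine h.trans (ENNReal.ofReal_le_ofReal ?_)
  have h2 : β + b * (K₀ * ε ^ (-κ) * η) ≤ β + b * (K * ε ^ (-κ) * η) := by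
    have := mul_le_mul_of_nonneg_left hmono hb
    linarith
  have h3 : 0 ≤ β + b * (K₀ * ε ^ (-κ) * η) := by positivity
  calc K' * (β + b * (K₀ * ε ^ (-κ) * η)) ≤ K * (β + b * (K₀ * ε ^ (-κ) * η)) :=
        mul_le_mul_of_nonneg_right hKK' h3
    _ ≤ K * (β + b * (K * ε ^ (-κ) * η)) := mul_le_mul_of_nonneg_left h2 hKpos.le


/-- QP3 — forced two-norm shadowing: LANDED BY NAME (`QuarterLogPincerQuietCollarShadowing.stub_forcedTwoNormShadowing`,
typer g36); line-local alias for the audit (v1.5). [tree theorem] -/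
theorem qp3_forcedTwoNormShadowing_landed : StubForcedTwoNormShadowing := stub_forcedTwoNormShadowing

/-! ### v1.1 — Q1 from its anatomy (PROVED composition) -/

set_option maxHeartbeats 1600000 in
/-- **Q1 FROM ITS ANATOMY (PROVED): QP1 → QP2 → QP3 → P2 → `FarFieldTruncation M v`** for a Type-I ancient
mild field with the log-cube budget — at the SAME rate constant `M` (the cut reference is dominated by `|v|`).
[this file; line theorem] -/
theorem farFieldTruncation_of_quietAnatomy {M : ℝ}
    {v : ℝ → EuclideanSpace ℝ (Fin 3) → EuclideanSpace ℝ (Fin 3)}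
    (hv : IsTypeIAncientMild M v) (hB : EnvelopeCubeBudget v)
    (h1 : QuietCollar v) (h2 : CutPair v) (h3 : ForcedTwoNormShadowing) (h4 : FrameBootstrap) :
    FarFieldTruncation M v := by
  intro δ hδ hδ1
  -- the rate constant is nonnegative
  have hM : 0 ≤ M := by
    have h := hv.2.2.2 (-1) (by norm_num) 0
    rw [neg_neg, Real.sqrt_one, div_one] at h
    exact (norm_nonneg _).trans h
  -- QP3 constants (depend on M only)
  obtain ⟨κ₃, K₃, hκ₃, hK₃, hsh⟩ := h3 M hM
  have hK₃pos : 0 < K₃ := by linarith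
  -- the sup target η₁ ε^{κ₃}, η₁ = δ/(2K₃)
  set η₁ : ℝ := δ / (2 * K₃) with hη₁
  have hη₁pos : 0 < η₁ := by positivity
  have hη₁le : η₁ ≤ δ / 2 := by
    rw [hη₁]
    exact div_le_div_of_nonneg_left hδ.le (by norm_num) (by linarith)
  -- QP2 constants for this target, QP1 constants for QP2's requests
  obtain ⟨k₂, K₂, hk₂, hK₂, hcut⟩ := h2 η₁ κ₃ hη₁pos hκ₃
  obtain ⟨κ₁, K₁, hκ₁, hK₁, hcol⟩ := h1 k₂ K₂ hk₂ hK₂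
  -- the budget constant
  obtain ⟨B, hB0, hbud⟩ := hB
  -- constants of Q1
  set c : ℝ := K₃ * (K₂ + 2) with hc
  have hcpos : 1 ≤ c := by
    have : (1 : ℝ) ≤ K₂ + 2 := by linarith
    calc (1 : ℝ) = 1 * 1 := by ring
      _ ≤ K₃ * (K₂ + 2) := mul_le_mul hK₃ this zero_le_one (by linarith)
  refine ⟨k₂ + (κ₁ + κ₁), max (K₂ * (K₁ * K₁)) (4 * (B + 1) * c ^ 3), by positivity, ?_, ?_⟩
  · refine le_max_of_le_right ?_
    have h1 : (1 : ℝ) ≤ c ^ 3 := one_le_pow₀ hcpos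
    have h2 : (1 : ℝ) ≤ 4 * (B + 1) := by linarith
    calc (1 : ℝ) = 1 * 1 := by ring
      _ ≤ 4 * (B + 1) * c ^ 3 := mul_le_mul h2 h1 zero_le_one (by linarith)
  intro ε hε
  have hεpos : 0 < ε := hε.1
  have hεhalf : ε ≤ 1 / 2 := hε.2
  have hεlt1 : ε < 1 := by linarith
  -- QP2's requests at ε, QP1's collar, QP2's cut pair
  obtain ⟨ηq, Lq, hηq, hLq, hLqK, hpair⟩ := hcut ε hε
  obtain ⟨r, hr2, hrK, hquiet⟩ := hcol ε hε ηq Lq hηq hLq hLqK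
  obtain ⟨R, V, u₀, hRlo, hRhi, hu₀s, hu₀d, hu₀c, hdata, hVcont, hVle, hVzero, hVeq, hVL3, hdef, hL3⟩ :=
    hpair r hr2 hquiet
  have hrpos : 0 < r := by linarith
  have hR2 : 2 ≤ R := by linarith
  -- the slab
  set T : ℝ := 1 - ε with hT
  have hTpos : 0 < T := by rw [hT]; linarith
  have hTlt : T < 1 := by rw [hT]; linarith
  -- the sup accuracy: K₃ ε^{-κ₃} (η₁ ε^{κ₃}) = δ/2
  have hεκ₃pos : 0 < ε ^ κ₃ := Real.rpow_pos_of_pos hεpos _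
  have hεκ₃ : ε ^ κ₃ ≤ 1 := Real.rpow_le_one hεpos.le hεlt1.le hκ₃
  have hηpos : 0 < η₁ * ε ^ κ₃ := mul_pos hη₁pos hεκ₃pos
  have hηle : η₁ * ε ^ κ₃ ≤ δ / 2 := (mul_le_of_le_one_right hη₁pos.le hεκ₃).trans hη₁le
  have hδw : K₃ * ε ^ (-κ₃) * (η₁ * ε ^ κ₃) = δ / 2 := by
    rw [Real.rpow_neg hεpos.le, hη₁]
    field_simp
  -- rate and boundedness of V
  have hVrate : ∀ t ∈ Icc 0 T, ∀ x, ‖V t x‖ ≤ M * (1 - t) ^ (-(1 / 2 : ℝ)) := by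
    intro t ht x
    have h1t : 0 < 1 - t := by rw [hT] at ht; linarith [ht.2]
    have h := hv.2.2.2 (t - 1) (by linarith) x
    have hneg : -(t - 1) = 1 - t := by ring
    rw [hneg, Real.sqrt_eq_rpow, div_eq_mul_inv, ← Real.rpow_neg h1t.le] at h
    exact (hVle t ht x).trans h
  have hsqε : 0 < Real.sqrt ε := Real.sqrt_pos.2 hεpos
  have hVbd : ∃ B' : ℝ, ∀ t ∈ Icc 0 T, ∀ x, ‖V t x‖ ≤ B' := by
    refine ⟨M / Real.sqrt ε, fun t ht x => (hVle t ht x).trans ?_⟩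
    have h := hv.2.2.2 (t - 1) (by rw [hT] at ht; linarith [ht.2]) x
    refine h.trans ?_
    have hneg : -(t - 1) = 1 - t := by ring
    rw [hneg]
    have hsq : Real.sqrt ε ≤ Real.sqrt (1 - t) := by
      apply Real.sqrt_le_sqrt; rw [hT] at ht; linarith [ht.2]
    exact div_le_div_of_nonneg_left hM hsqε hsq
  have hVdec : ∀ η : ℝ, 0 < η → ∃ R' : ℝ, ∀ t ∈ Icc 0 T, ∀ x : EuclideanSpace ℝ (Fin 3),
      R' ≤ ‖x‖ → ‖V t x‖ ≤ η := by
    intro η hη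
    exact ⟨R, fun t ht x hx => by rw [hVzero t ht x hx, norm_zero]; exact hη.le⟩
  have hVzero' : ∃ R' : ℝ, ∀ t ∈ Icc 0 (1 - ε), ∀ x : EuclideanSpace ℝ (Fin 3), R' ≤ ‖x‖ → V t x = 0 :=
    ⟨R, hVzero⟩
  -- data closeness
  have hclose0 : ∀ x, ‖u₀ x - V 0 x‖ ≤ δ / 2 := fun x => (hdata x).trans hηle
  -- the improvement from QP3 (sup part)
  have himp : ∀ T' ∈ Ioc 0 T, ∀ (u : ℝ → EuclideanSpace ℝ (Fin 3) → EuclideanSpace ℝ (Fin 3))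
      (p : ℝ → EuclideanSpace ℝ (Fin 3) → ℝ), TaoFrame T' u p → u 0 = u₀ →
      (∀ t ∈ Icc 0 T', ∀ x, ‖u t x - V t x‖ ≤ 2 * δ) →
      ∀ t ∈ Icc 0 T', ∀ x, ‖u t x - V t x‖ ≤ δ := by
    intro T' hT' u p hframe hu0 hboot
    have hboot2 : ∀ t ∈ Icc 0 T', ∀ x, ‖u t x - V t x‖ ≤ 2 :=
      fun t ht x => (hboot t ht x).trans (by linarith)
    have h := (hsh ε hε (η₁ * ε ^ κ₃) hηpos.le V hVcont hVrate hVzero' hdef u₀ hdata T' hT' u p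
      hframe hu0 hboot2).1
    intro t ht x
    have := h t ht x
    rw [hδw] at this
    linarith
  -- P2: the Tao-frame solution on [0, 1-ε]
  obtain ⟨u, p, hframe, hu0, hclose⟩ :=
    h4 T δ u₀ V hTpos hδ hu₀s hu₀d hu₀c hVcont hVbd hVdec hclose0 himp
  -- QP3 on the full slab
  have hTmem : T ∈ Ioc 0 T := ⟨hTpos, le_rfl⟩
  have hboot2 : ∀ t ∈ Icc 0 T, ∀ x, ‖u t x - V t x‖ ≤ 2 :=
    fun t ht x => (hclose t ht x).trans (by linarith)
  obtain ⟨hsup, hL3w⟩ :=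
    hsh ε hε (η₁ * ε ^ κ₃) hηpos.le V hVcont hVrate hVzero' hdef u₀ hdata T hTmem u p hframe hu0 hboot2
  have hsupδ : ∀ t ∈ Icc 0 T, ∀ x, ‖u t x - V t x‖ ≤ δ / 2 := by
    intro t ht x
    have := hsup t ht x
    rwa [hδw] at this
  -- the internal budget at (R, ε) and the L³ size of w = u - V
  obtain ⟨bs, hbs0, hbscube, hbsv⟩ := hbud R hR2 ε ⟨hεpos, hεlt1.le⟩
  have hVb : ∀ t ∈ Icc 0 (1 - ε), eLpNorm (V t) 3 volume ≤ ENNReal.ofReal bs := by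
    intro t ht
    refine (hVL3 t ht).trans (hbsv (t - 1) ?_)
    constructor <;> linarith [ht.1, ht.2]
  obtain ⟨hdataL3, hdefL3⟩ := hL3 bs hbs0 hbsv
  have hδw1 : K₃ * ε ^ (-κ₃) * (η₁ * ε ^ κ₃) ≤ 1 := by rw [hδw]; linarith
  have hwL3 := hL3w (K₂ * (bs + 1)) bs (by positivity) hbs0 hδw1 hdataL3 hdefL3 hVb
  rw [hδw] at hwL3
  set k : ℝ := K₃ * (K₂ * (bs + 1) + bs * (δ / 2)) with hk
  have hk0 : 0 ≤ k := by positivity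
  have hkc : k ≤ c * (bs + 1) := by
    rw [hk, hc]
    have h1 : K₂ * (bs + 1) + bs * (δ / 2) ≤ (K₂ + 2) * (bs + 1) := by nlinarith
    calc K₃ * (K₂ * (bs + 1) + bs * (δ / 2)) ≤ K₃ * ((K₂ + 2) * (bs + 1)) :=
          mul_le_mul_of_nonneg_left h1 (by linarith)
      _ = K₃ * (K₂ + 2) * (bs + 1) := by ring
  -- assemble Q1 at this ε
  refine ⟨R, u, p, hR2, ?_, hframe, ?_, ⟨k, hk0, ?_, ?_⟩, ?_⟩
  · -- R ≤ K ε^{-κ}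
    have hrK' : r ≤ K₁ * ε ^ (-κ₁) := by linarith
    have hεk₂ : 0 ≤ ε ^ (-k₂) := Real.rpow_nonneg hεpos.le _
    have hεκ₁ : 0 ≤ ε ^ (-κ₁) := Real.rpow_nonneg hεpos.le _
    have hrr : r * r ≤ (K₁ * ε ^ (-κ₁)) * (K₁ * ε ^ (-κ₁)) :=
      mul_le_mul hrK' hrK' hrpos.le (by positivity)
    have hexp : ε ^ (-(k₂ + (κ₁ + κ₁))) = ε ^ (-k₂) * (ε ^ (-κ₁) * ε ^ (-κ₁)) := by
      rw [← Real.rpow_add hεpos, ← Real.rpow_add hεpos]; ring_nf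
    calc R ≤ K₂ * ε ^ (-k₂) * (r * r) := hRhi
      _ ≤ K₂ * ε ^ (-k₂) * ((K₁ * ε ^ (-κ₁)) * (K₁ * ε ^ (-κ₁))) :=
          mul_le_mul_of_nonneg_left hrr (by positivity)
      _ = (K₂ * (K₁ * K₁)) * ε ^ (-(k₂ + (κ₁ + κ₁))) := by rw [hexp]; ring
      _ ≤ max (K₂ * (K₁ * K₁)) (4 * (B + 1) * c ^ 3) * ε ^ (-(k₂ + (κ₁ + κ₁))) :=
          mul_le_mul_of_nonneg_right (le_max_left _ _) (Real.rpow_nonneg hεpos.le _)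
  · -- (i) the virtual Type-I bound with constant M + 1
    intro t ht x
    have ht' : t ∈ Icc 0 T := by simpa [hT] using ht
    have h1t : 0 < 1 - t := by rw [hT] at ht'; linarith [ht'.2]
    have h1t' : 1 - t ≤ 1 := by linarith [ht'.1]
    have hone : (1 : ℝ) ≤ (1 - t) ^ (-(1 / 2 : ℝ)) :=
      Real.one_le_rpow_of_pos_of_le_one_of_nonpos h1t h1t' (by norm_num)
    have hw : ‖u t x - V t x‖ ≤ δ / 2 := hsupδ t ht' x
    have hVx : ‖V t x‖ ≤ M * (1 - t) ^ (-(1 / 2 : ℝ)) := hVrate t ht' x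
    have heq : (1 - ε + ε - t) = 1 - t := by ring
    rw [heq]
    calc ‖u t x‖ = ‖(u t x - V t x) + V t x‖ := by abel_nf
      _ ≤ ‖u t x - V t x‖ + ‖V t x‖ := norm_add_le _ _
      _ ≤ δ / 2 + M * (1 - t) ^ (-(1 / 2 : ℝ)) := by linarith
      _ ≤ 1 * (1 - t) ^ (-(1 / 2 : ℝ)) + M * (1 - t) ^ (-(1 / 2 : ℝ)) := by nlinarith
      _ = (M + 1) * (1 - t) ^ (-(1 / 2 : ℝ)) := by ring
  · -- (ii) the cube-log shape of k
    have hlogR : 0 ≤ Real.log R := Real.log_nonneg (by linarith)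
    have hlogε : 0 ≤ Real.log (1 / ε) := by
      apply Real.log_nonneg; rw [le_div_iff₀ hεpos]; linarith
    have hL : 1 ≤ 1 + Real.log R + Real.log (1 / ε) := by linarith
    have h1 : k ^ 3 ≤ (c * (bs + 1)) ^ 3 := by gcongr
    have h2 : (bs + 1) ^ 3 ≤ 4 * bs ^ 3 + 4 * 1 ^ 3 := DyadicChaining.add_pow_three_le_four hbs0 zero_le_one
    have h3 : (c * (bs + 1)) ^ 3 = c ^ 3 * (bs + 1) ^ 3 := by ring
    have hc3 : 0 ≤ c ^ 3 := by positivity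
    have h4 : c ^ 3 * (bs + 1) ^ 3 ≤ c ^ 3 * (4 * (B * (1 + Real.log R + Real.log (1 / ε)) + 1)) := by
      refine mul_le_mul_of_nonneg_left ?_ hc3
      calc (bs + 1) ^ 3 ≤ 4 * bs ^ 3 + 4 * 1 ^ 3 := h2
        _ ≤ 4 * (B * (1 + Real.log R + Real.log (1 / ε)) + 1) := by
            simp only [one_pow]; linarith [hbscube]
    have h5' : c ^ 3 * 1 ≤ c ^ 3 * (1 + Real.log R + Real.log (1 / ε)) :=
      mul_le_mul_of_nonneg_left hL hc3
    have h5 : c ^ 3 * (4 * (B * (1 + Real.log R + Real.log (1 / ε)) + 1)) ≤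
        4 * (B + 1) * c ^ 3 * (1 + Real.log R + Real.log (1 / ε)) := by
      have hexpand : 4 * (B + 1) * c ^ 3 * (1 + Real.log R + Real.log (1 / ε)) -
          c ^ 3 * (4 * (B * (1 + Real.log R + Real.log (1 / ε)) + 1)) =
          4 * (c ^ 3 * (1 + Real.log R + Real.log (1 / ε)) - c ^ 3 * 1) := by ring
      linarith [hexpand, h5']
    have h6 : 4 * (B + 1) * c ^ 3 * (1 + Real.log R + Real.log (1 / ε)) ≤
        max (K₂ * (K₁ * K₁)) (4 * (B + 1) * c ^ 3) * (1 + Real.log R + Real.log (1 / ε)) :=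
      mul_le_mul_of_nonneg_right (le_max_right _ _) (by linarith)
    calc k ^ 3 ≤ (c * (bs + 1)) ^ 3 := h1
      _ = c ^ 3 * (bs + 1) ^ 3 := h3
      _ ≤ _ := h4
      _ ≤ _ := h5
      _ ≤ _ := h6
  · -- (ii) the L³ bound ‖u t‖₃ ≤ b + k for every admissible b
    intro b hb hbv t ht
    have ht' : t ∈ Icc 0 T := by simpa [hT] using ht
    have htε : t ∈ Icc 0 (1 - ε) := by simpa [hT] using ht'
    have hucont : Continuous (u t) :=
      (hframe.1.contDiff_velocity (by simpa [hT] using ht)).continuous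
    have hVtcont : Continuous (fun x => V t x) := by
      have hc := hVcont.comp_continuous (f := fun x : EuclideanSpace ℝ (Fin 3) => (t, x))
        (by fun_prop) (fun x => ⟨htε, mem_univ _⟩)
      exact hc
    have hwcont : Continuous (fun x => u t x - V t x) := hucont.sub hVtcont
    have hm1 : AEStronglyMeasurable (fun x => V t x) volume := hVtcont.aestronglyMeasurable
    have hm2 : AEStronglyMeasurable (fun x => u t x - V t x) volume := hwcont.aestronglyMeasurable
    have hsplit : u t = (fun x => V t x) + fun x => u t x - V t x := by
      funext x; simp
    have h3 : (1 : ℝ≥0∞) ≤ 3 := by norm_num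
    have hVt : eLpNorm (fun x => V t x) 3 volume ≤ ENNReal.ofReal b := by
      have hs : t - 1 ∈ Icc (-1 : ℝ) (-ε) := by constructor <;> linarith [htε.1, htε.2]
      exact (hVL3 t htε).trans (hbv (t - 1) hs)
    have hwt : eLpNorm (fun x => u t x - V t x) 3 volume ≤ ENNReal.ofReal k := hwL3 t ht'
    have step : eLpNorm ((fun x => V t x) + fun x => u t x - V t x) 3 volume ≤
        eLpNorm (fun x => V t x) 3 volume + eLpNorm (fun x => u t x - V t x) 3 volume :=
      eLpNorm_add_le hm1 hm2 h3
    have hfin : ENNReal.ofReal b + ENNReal.ofReal k = ENNReal.ofReal (b + k) :=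
      (ENNReal.ofReal_add hb hk0).symm
    rw [hsplit]
    exact (step.trans (add_le_add hVt hwt)).trans hfin.le
  · -- (iii) δ-closeness on the unit ball at the final time
    intro x hx
    have hTmem' : T ∈ Icc 0 T := ⟨hTpos.le, le_rfl⟩
    have hTε : T ∈ Icc 0 (1 - ε) := by simpa [hT] using hTmem'
    have hxr : ‖x‖ ≤ r := by
      have : ‖x‖ < 1 := by simpa using hx
      linarith
    have hVx : V T x = v (-ε) x := by
      have h := hVeq T hTε x hxr
      have : T - 1 = -ε := by rw [hT]; ring
      rw [this] at h
      exact h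
    have h := hsupδ T hTmem' x
    rw [hVx] at h
    have hgoal : ‖u T x - v (-ε) x‖ ≤ δ := by linarith
    simpa [hT] using hgoal

/-- **Q1 from the three registered pieces and the landed P2 (PROVED).** [this file; line theorem] -/
theorem stubQuietTruncation_of_anatomy (h1 : StubQuietCollar) (h2 : StubCutPair)
    (h3 : StubForcedTwoNormShadowing) (h4 : StubFrameBootstrap) : StubQuietTruncation :=
  fun M v hv hB => ⟨M, farFieldTruncation_of_quietAnatomy hv hB (h1 M v hv hB) (h2 M v hv hB) h3 h4⟩

/-- Q1 — quiet-collar truncation stability, now DERIVED (kernel) from the three piece stubs QP1–QP3 and the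
LANDED frame bootstrap `TruncationEdge.stub_frameBootstrap` (P2 of `truncation_edge`, BY NAME).
[this file; line theorem modulo QP1–QP3] -/
theorem stub_quietTruncation : StubQuietTruncation :=
  stubQuietTruncation_of_anatomy stub_quietCollar stub_cutPair stub_forcedTwoNormShadowing stub_frameBootstrap



/-! ### The arithmetic family from a localised floor (PROVED) -/

/-- **From the parts to a truncated family, with a LOCALISED floor** (replacing the envelope of
`TruncationEdge.truncatedFamily_of_parts`): T1's conclusion at accuracy `δ = min 1 (c/2)`, the log-cube budget
with `log R ≤ log K + κ log(1/ε)`, the floor point in `B(1)` for `ε ≤ −s₀`. [this file; line theorem] -/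
theorem truncatedFamily_of_localFloor {M : ℝ}
    {v : ℝ → EuclideanSpace ℝ (Fin 3) → EuclideanSpace ℝ (Fin 3)}
    (hT : FarFieldTruncation M v) (hBud : EnvelopeCubeBudget v) (hF : LocalRateFloor v) :
    ∃ K₁ K₂ c ε₀ : ℝ, 0 < K₂ ∧ 0 < c ∧ 0 < ε₀ ∧ ε₀ ≤ 1 / 2 ∧
      TruncatedFamily (M + 1) K₁ K₂ c ε₀ := by
  obtain ⟨c, s₀, hc, hs₀, hfloor⟩ := hF
  obtain ⟨κ, K, hκ, hK, hfam⟩ := hT (min 1 (c / 2)) (by positivity) (min_le_left _ _)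
  obtain ⟨B', hB0, hbud⟩ := hBud
  have hKpos : 0 < K := by linarith
  refine ⟨32 + 16 * (B' + K) * (1 + Real.log K), 16 * (B' + K) * (κ + 1) + 1, c / 2,
    min (1 / 2) (-s₀), by positivity, by positivity, lt_min (by norm_num) (by linarith),
    min_le_left _ _, ?_⟩
  intro ε hε
  have hεpos : 0 < ε := hε.1
  have hεhalf : ε ≤ 1 / 2 := hε.2.trans (min_le_left _ _)
  have hεs₀ : ε ≤ -s₀ := hε.2.trans (min_le_right _ _)
  have hεone : ε ≤ 1 := by linarith
  obtain ⟨R, u, p, hR2, hRK, hframe, hrate, ⟨k, hk0, hk3, hL3⟩, hclose⟩ := hfam ε ⟨hεpos, hεhalf⟩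
  obtain ⟨b, hb0, hb3, hbv⟩ := hbud R hR2 ε ⟨hεpos, hεone⟩
  have hL3u := hL3 b hb0 hbv
  have hlog1 : 0 ≤ Real.log (1 / ε) := by
    apply Real.log_nonneg
    rw [le_div_iff₀ hεpos]; linarith
  have hlogR : Real.log R ≤ Real.log K + κ * Real.log (1 / ε) := by
    have hRpos : 0 < R := by linarith
    have h1 : Real.log R ≤ Real.log (K * ε ^ (-κ)) := Real.log_le_log hRpos hRK
    have h2 : Real.log (K * ε ^ (-κ)) = Real.log K + κ * Real.log (1 / ε) := by
      rw [Real.log_mul hKpos.ne' (Real.rpow_pos_of_pos hεpos _).ne', Real.log_rpow hεpos,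
        one_div, Real.log_inv]
      ring
    linarith
  refine ⟨2 + b + k, u, p, hframe, hrate, fun t ht => (hL3u t ht).trans
    (ENNReal.ofReal_le_ofReal (by linarith)), by linarith, ?_, ?_⟩
  · have h1 : (2 + b + k) ^ 3 ≤ 4 * 2 ^ 3 + 4 * (b + k) ^ 3 := by
      have := DyadicChaining.add_pow_three_le_four (x := 2) (y := b + k) (by norm_num) (by linarith)
      calc (2 + b + k) ^ 3 = (2 + (b + k)) ^ 3 := by ring
        _ ≤ 4 * 2 ^ 3 + 4 * (b + k) ^ 3 := this
    have h1' : (b + k) ^ 3 ≤ 4 * b ^ 3 + 4 * k ^ 3 := DyadicChaining.add_pow_three_le_four hb0 hk0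
    have hLle : 1 + Real.log R + Real.log (1 / ε) ≤
        1 + Real.log K + (κ + 1) * Real.log (1 / ε) := by linarith
    have hBK : 0 ≤ B' + K := by linarith
    have h2 : b ^ 3 + k ^ 3 ≤ (B' + K) * (1 + Real.log R + Real.log (1 / ε)) := by nlinarith
    have h3 : (B' + K) * (1 + Real.log R + Real.log (1 / ε)) ≤
        (B' + K) * (1 + Real.log K + (κ + 1) * Real.log (1 / ε)) :=
      mul_le_mul_of_nonneg_left hLle hBK
    have h4 : 16 * (B' + K) * (κ + 1) * Real.log (1 / ε) ≤
        (16 * (B' + K) * (κ + 1) + 1) * Real.log (1 / ε) :=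
      mul_le_mul_of_nonneg_right (by linarith) hlog1
    nlinarith [h1, h1', h2, h3, h4]
  · -- the floor, already localised in the unit ball for `−ε ∈ [s₀, 0)`
    obtain ⟨x, hxball, hx⟩ := hfloor (-ε) ⟨by linarith, by linarith⟩
    rw [neg_neg] at hx
    have hsq : 0 < Real.sqrt ε := Real.sqrt_pos.2 hεpos
    have hcl := hclose x hxball
    have hδ : min 1 (c / 2) ≤ c / 2 := min_le_right _ _
    have htri : ‖v (-ε) x‖ - ‖u (1 - ε) x‖ ≤ ‖u (1 - ε) x - v (-ε) x‖ := by
      rw [norm_sub_rev]; exact norm_sub_norm_le _ _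
    refine ⟨x, ?_⟩
    have hhalf : c / 2 ≤ c / 2 / Real.sqrt ε := by
      have hsq1 : Real.sqrt ε ≤ 1 := by
        rw [← Real.sqrt_one]; exact Real.sqrt_le_sqrt hεone
      rw [le_div_iff₀ hsq]; nlinarith
    have : c / Real.sqrt ε = c / 2 / Real.sqrt ε + c / 2 / Real.sqrt ε := by ring
    linarith

/-! ### The loop: 24077 ⇒ LogCubeFloorLiouville (modulo Q1 ALONE) and the converse (modulo Q2) -/

/-- **A log-cube field with a localised floor refutes the crux, given Q1** (with the landed arithmetic core
`not_typeIQuantSubcubicExp_of_truncatedFamily`). [this file; line theorem] -/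
theorem not_typeIQuantSubcubicExp_of_logCube_floor (hQ1 : StubQuietTruncation) {M : ℝ}
    {v : ℝ → EuclideanSpace ℝ (Fin 3) → EuclideanSpace ℝ (Fin 3)}
    (hv : IsTypeIAncientMild M v) (hbud : EnvelopeCubeBudget v) (hfloor : LocalRateFloor v) :
    ¬ Summit.NavierStokesRegularity.NavierStokesRegularity.Theses.QuarterLogPincer.TypeIQuantSubcubicExp := by
  obtain ⟨M', hT⟩ := hQ1 M v hv hbud
  obtain ⟨K₁, K₂, c, ε₀, hK₂, hc, hε₀, hε₀', hTF⟩ := truncatedFamily_of_localFloor hT hbud hfloor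
  exact not_typeIQuantSubcubicExp_of_truncatedFamily hK₂ hc hε₀ hε₀' hTF

/-- **THE EDGE — 24077 ⇒ LOG-CUBE FLOOR LIOUVILLE, modulo the single input Q1.** [this file; line theorem] -/
theorem logCubeFloorLiouville_of_typeIQuantSubcubicExp (hQ1 : StubQuietTruncation)
    (h : Summit.NavierStokesRegularity.NavierStokesRegularity.Theses.QuarterLogPincer.TypeIQuantSubcubicExp) :
    LogCubeFloorLiouville :=
  fun _ _ hv hbud hfloor => not_typeIQuantSubcubicExp_of_logCube_floor hQ1 hv hbud hfloor h

/-- Value upgrade: with Q3, 24077 ⇒ `LogCubeLiouville` (the `SingularAt` form). [this file; line theorem] -/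
theorem logCubeLiouville_of_typeIQuantSubcubicExp (hQ1 : StubQuietTruncation) (hQ3 : StubLocalRateFloor)
    (h : Summit.NavierStokesRegularity.NavierStokesRegularity.Theses.QuarterLogPincer.TypeIQuantSubcubicExp) :
    LogCubeLiouville :=
  fun M v hv hbud hsing =>
    logCubeFloorLiouville_of_typeIQuantSubcubicExp hQ1 h M v hv hbud (hQ3 M v hv hsing)

/-- (Q3♭, v1.6 note) **The class-restricted rate floor the loop ACTUALLY consumes.**  `logCubeLiouville_of_typeIQuantSubcubicExp`
applies Q3 only at fields carrying `EnvelopeCubeBudget`; that restricted statement — identical to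
`…Cruxes.TypeIQuantSubcubicExp.QuietCore.LocalRateFloorLogCube` — is **PROVED** (kernel, std axioms, no sorry in its cone) in the sibling
workfile `Lines/quiet_core.lean` v1.5+ (`localRateFloorLogCube`, via the quiet-core propagation `quietCore_all`; workfiles are not
importable, so it enters here BY STATEMENT).  Hence the loop's VALUE side needs no flicker-risk Q3: see the `_flat` variant below.
RECOMMENDATION to the lead/director: re-cut the registered Q3 `stub_localRateFloor : StubLocalRateFloor` to this statement (or port
quiet_core §1–§2 to Theorems and cite it by name). -/
def LocalRateFloorLogCube : Prop :=
  ∀ (M : ℝ) (v : ℝ → EuclideanSpace ℝ (Fin 3) → EuclideanSpace ℝ (Fin 3)),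
    IsTypeIAncientMild M v → EnvelopeCubeBudget v → SingularAt v 0 → LocalRateFloor v

/-- Q3 ⇒ Q3♭ (trivial). -/
theorem localRateFloorLogCube_of_stub (hQ3 : StubLocalRateFloor) : LocalRateFloorLogCube :=
  fun M v hv _ hs => hQ3 M v hv hs

/-- Value upgrade with Q3♭ in place of Q3: 24077 ⇒ `LogCubeLiouville`, modulo Q1 (edge) and the PROVED-elsewhere Q3♭ only. -/
theorem logCubeLiouville_of_typeIQuantSubcubicExp_flat (hQ1 : StubQuietTruncation) (hQ3 : LocalRateFloorLogCube)
    (h : Summit.NavierStokesRegularity.NavierStokesRegularity.Theses.QuarterLogPincer.TypeIQuantSubcubicExp) :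
    LogCubeLiouville :=
  fun M v hv hbud hsing =>
    logCubeFloorLiouville_of_typeIQuantSubcubicExp hQ1 h M v hv hbud (hQ3 M v hv hbud hsing)

/-- **THE CONVERSE — LOG-CUBE FLOOR LIOUVILLE ⇒ 24077, modulo Q2.** [this file; line theorem] -/
theorem typeIQuantSubcubicExp_of_logCubeFloorLiouville (hQ2 : StubLogCubeExtraction)
    (hL : LogCubeFloorLiouville) :
    Summit.NavierStokesRegularity.NavierStokesRegularity.Theses.QuarterLogPincer.TypeIQuantSubcubicExp := by
  by_contra h
  obtain ⟨M, v, hv, hbud, hfloor⟩ := hQ2 h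
  exact hL M v hv hbud hfloor

/-- **THE LOOP: modulo Q1 (edge) and Q2 (converse) the crux 24077 IS the log-cube floor Liouville theorem.**
[this file; line theorem — the target of the line] -/
theorem typeIQuantSubcubicExp_iff_logCubeFloorLiouville (hQ1 : StubQuietTruncation)
    (hQ2 : StubLogCubeExtraction) :
    Summit.NavierStokesRegularity.NavierStokesRegularity.Theses.QuarterLogPincer.TypeIQuantSubcubicExp ↔
      LogCubeFloorLiouville :=
  ⟨logCubeFloorLiouville_of_typeIQuantSubcubicExp hQ1, typeIQuantSubcubicExp_of_logCubeFloorLiouville hQ2⟩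

/-- The same, over the registered stubs BY NAME. [this file; line theorem modulo the stubs] -/
theorem typeIQuantSubcubicExp_iff_logCubeFloorLiouville₀ :
    Summit.NavierStokesRegularity.NavierStokesRegularity.Theses.QuarterLogPincer.TypeIQuantSubcubicExp ↔
      LogCubeFloorLiouville :=
  typeIQuantSubcubicExp_iff_logCubeFloorLiouville stub_quietTruncation stub_logCubeExtraction

/-- The proving-polarity reading (crux BY NAME from the Liouville value and Q2). [this file; line theorem] -/
theorem TypeIQuantSubcubicExp_of (hQ2 : StubLogCubeExtraction) (hL : LogCubeFloorLiouville) :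
    Summit.NavierStokesRegularity.NavierStokesRegularity.Theses.QuarterLogPincer.TypeIQuantSubcubicExp :=
  typeIQuantSubcubicExp_of_logCubeFloorLiouville hQ2 hL

/-! ### Rungs and comparison with the closed edge of `truncation_edge` (PROVED) -/

/-- **RUNG OF Q3: the localised floor holds for every ENVELOPED singular Type-I ancient mild field** — the
landed global floor T4 (`stub_rateFloor`) plus the envelope `|v| ≤ A/(|x| + √(−s))` force the floor point
into `B(1)` once `√(−s) < c/(A + c)`. [this file; line theorem] -/
theorem localRateFloor_of_hasTypeIDecay {M A : ℝ}
    {v : ℝ → EuclideanSpace ℝ (Fin 3) → EuclideanSpace ℝ (Fin 3)}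
    (hv : IsTypeIAncientMild M v) (hdec : HasTypeIDecay A v) (hsing : SingularAt v 0) :
    LocalRateFloor v := by
  obtain ⟨c, hc, hfloor⟩ := stub_rateFloor M v hv hsing
  have hA : 0 ≤ A := by
    have h := hdec (-1) (by norm_num) 0
    simp only [norm_zero, neg_neg, Real.sqrt_one, zero_add, div_one] at h
    exact (norm_nonneg _).trans h
  set η : ℝ := c / (2 * (A + c)) with hη
  have hηpos : 0 < η := by positivity
  have hη1 : η ^ 2 < 1 := by
    have hηlt : η < 1 := by
      rw [hη, div_lt_one (by positivity)]; nlinarith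
    nlinarith
  refine ⟨c, -η ^ 2, hc, by nlinarith, fun s hs => ?_⟩
  obtain ⟨x, hx⟩ := hfloor s ⟨by linarith [hs.1], hs.2⟩
  have hspos : 0 < -s := by linarith [hs.2]
  have hsq : 0 < Real.sqrt (-s) := Real.sqrt_pos.2 hspos
  have hsqη : Real.sqrt (-s) ≤ η := by
    calc Real.sqrt (-s) ≤ Real.sqrt (η ^ 2) := Real.sqrt_le_sqrt (by linarith [hs.1])
      _ = η := Real.sqrt_sq hηpos.le
  have henv : ‖v s x‖ ≤ A / (‖x‖ + Real.sqrt (-s)) := hdec s hs.2 x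
  have hden : 0 < ‖x‖ + Real.sqrt (-s) := by positivity
  have h1 : c * (‖x‖ + Real.sqrt (-s)) ≤ A * Real.sqrt (-s) :=
    (div_le_div_iff₀ hsq hden).1 (hx.trans henv)
  have hx1 : ‖x‖ < 1 := by
    have h2 : c * ‖x‖ ≤ A * Real.sqrt (-s) := by nlinarith [norm_nonneg x]
    have h3 : A * Real.sqrt (-s) ≤ A * η := mul_le_mul_of_nonneg_left hsqη hA
    have h4 : A * η < c := by
      rw [hη, ← mul_div_assoc, div_lt_iff₀ (by positivity)]
      nlinarith
    nlinarith
  exact ⟨x, by rwa [Metric.mem_ball, dist_zero_right], hx⟩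

/-- **Log-cube floor Liouville implies the envelope-class Liouville statement** (the right-hand side of the
closed edge `TruncationEdge.typeIQuantSubcubicExp_implies_envelopeLiouville`), by the LANDED T3
`stub_envelopeCubeBudget` and the rung `localRateFloor_of_hasTypeIDecay`: the loop's value dominates the
edge's. [this file; line theorem] -/
theorem envelopeLiouville_of_logCubeFloorLiouville (hL : LogCubeFloorLiouville) :
    ∀ (C A : ℝ) (w : ℝ → EuclideanSpace ℝ (Fin 3) → EuclideanSpace ℝ (Fin 3)),
      IsTypeIAncientMild C w → HasTypeIDecay A w → ¬ SingularAt w 0 := by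
  intro C A w hw hdec hsing
  have hA : 0 ≤ A := by
    have h := hdec (-1) (by norm_num) 0
    simp only [norm_zero, neg_neg, Real.sqrt_one, zero_add, div_one] at h
    exact (norm_nonneg _).trans h
  exact hL C w hw (stub_envelopeCubeBudget A w hA hdec) (localRateFloor_of_hasTypeIDecay hw hdec hsing)

/-- `LogCubeLiouville` also implies the envelope-class Liouville statement (landed T3 only). [this file; line
theorem] -/
theorem envelopeLiouville_of_logCubeLiouville (hL : LogCubeLiouville) :
    ∀ (C A : ℝ) (w : ℝ → EuclideanSpace ℝ (Fin 3) → EuclideanSpace ℝ (Fin 3)),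
      IsTypeIAncientMild C w → HasTypeIDecay A w → ¬ SingularAt w 0 := by
  intro C A w hw hdec
  have hA : 0 ≤ A := by
    have h := hdec (-1) (by norm_num) 0
    simp only [norm_zero, neg_neg, Real.sqrt_one, zero_add, div_one] at h
    exact (norm_nonneg _).trans h
  exact hL C w hw (stub_envelopeCubeBudget A w hA hdec)

/-- **Consistency with the closed edge**: given Q1 alone, 24077 already excludes every ENVELOPED singular
Type-I ancient mild field through THIS line's family (Q3 discharged by `localRateFloor_of_hasTypeIDecay`) —
the statement `truncation_edge` v1.9.1 proves with no stub at all. [this file; line theorem] -/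
theorem envelopeLiouville_of_typeIQuantSubcubicExp_of_Q1 (hQ1 : StubQuietTruncation)
    (h : Summit.NavierStokesRegularity.NavierStokesRegularity.Theses.QuarterLogPincer.TypeIQuantSubcubicExp)
    {C A : ℝ} {w : ℝ → EuclideanSpace ℝ (Fin 3) → EuclideanSpace ℝ (Fin 3)}
    (hw : IsTypeIAncientMild C w) (hdec : HasTypeIDecay A w) : ¬ SingularAt w 0 := by
  intro hsing
  have hA : 0 ≤ A := by
    have h := hdec (-1) (by norm_num) 0
    simp only [norm_zero, neg_neg, Real.sqrt_one, zero_add, div_one] at h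
    exact (norm_nonneg _).trans h
  exact not_typeIQuantSubcubicExp_of_logCube_floor hQ1 hw (stub_envelopeCubeBudget A w hA hdec)
    (localRateFloor_of_hasTypeIDecay hw hdec hsing) h

end Summit.NavierStokesRegularity.NavierStokesRegularity.Cruxes.TypeIQuantSubcubicExp.QuietCollar

end
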